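import Summits.CriticalPhenomena.PercolationContinuityZ3.Theorems.Transplant.PlanarSkeletonFrmFromDefs
import Summits.CriticalPhenomena.PercolationContinuityZ3.Theorems.Transplant.SkelFrmFromBFaceBVC5
import Summits.CriticalPhenomena.PercolationContinuityZ3.Theorems.Transplant.SkelFrmFromBFaceFrameRowsV
import Summits.CriticalPhenomena.PercolationContinuityZ3.Theorems.Transplant.SkelFrmBParamsFaceFloorsHypsFW
import Summits.CriticalPhenomena.PercolationContinuityZ3.Theorems.Transplant.SkelFrmFromBParamsFaceLamA
import Summits.CriticalPhenomena.PercolationContinuityZ3.Theorems.Transplant.SkelFrmFromBChoiceZoneK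
import Summits.CriticalPhenomena.PercolationContinuityZ3.Theorems.Transplant.SkelFrmFromBChoiceDefsV
import Summits.CriticalPhenomena.PercolationContinuityZ3.Theorems.Transplant.SkelFrmFromBParamsSchedA
import HarnessLib
import Summits.CriticalPhenomena.PercolationContinuityZ3.Theorems.Transplant.SkelFrmFromBChoiceResidF2
import Summits.CriticalPhenomena.PercolationContinuityZ3.Theorems.Transplant.SkelFrmFrom1ChoiceLTK
import Summits.CriticalPhenomena.PercolationContinuityZ3.Theorems.Transplant.SkelFrmBFaceHoldsQ3VOf
-- MERGED FORM 92′ (hp-8 g51; lead g20 RULING F-C 2026-08-26T04:03:48Z): row 91 «SkelFrmBFaceBVC7» (p415867, accepted, never dispatched) carried inside as private theorems faceOblRM_frmBVC₆′/₇′; imports re-based on BVC5; the public statement of row 92 token-for-token the v2.3 text d6a7ec7a….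
/-!
# U-WAVE PORT (RULING D-U, lead g21 2026-08-26; WAVE-U-MANIFEST row «SkelFrmBFaceHoldsQ3VOf» ↦ «SkelFrmFromBFaceHoldsQ3VOf») onto the carrier `PlanarSkeletonFrmFrom`. ORIGINAL TITLE: N2 (frames-only node, OPEN) — (F) column, THE WRAPPER's LAYER (a6): `NegB.faceOblRM_frmBVC₆` = layer (a5) `faceOblRM_frmBVC₅` WITH THE NUMBERS BATCH's FRAME,
builds on p205010 (kernel theorem, internal audit signed; external expert review pending) — unused here; NOTHING claimed about the OPEN node U `SamePDropOfSkeletonFrmFrom₁` / U_s / end state.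
Seat `prim-hp-8 gen 53 (U-wave port pen, family P-hp8; tool of record = p3-g26 port_u.py)`; helper (`--supports stmt-CriticalPhenomena-4575 --as helper`). Rules r1–r4: declaration order + proof texts = the original's, byte-identical except the
carrier token, `export`ed twin-free residents / omitted φ-level blocks (policy T / (m1)), explicit carrier binders (r2, inlined). Docstrings/citations are the original's. SHORT-HEADER + COMPACT-IMPORTS (400-line cap).  Manifest row idx 236 (level 32; flags verbatim); filed by the hp-8 lineage under RULING M-11 (family P-hp8); 400-line cap: COMPACT-IMPORTS|SHORT-HEADER.
-/

noncomputable section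

open scoped Classical ENNReal

namespace Summit.CriticalPhenomena.PercolationContinuityZ3.Theorems.Transplant

namespace PlanarSkeletonFrmFrom

namespace NegB

open MeasureTheory Literature.Probability.Percolation Literature.Probability.LatticeModels SimpleGraph KNCells KNLevels GadgetSystem Contour
open Literature.Probability.Percolation.KozmaNitzan
open Literature.Probability.Percolation.KozmaNitzan.Cells (oth sgOf sgOf_sign stepVec_apply_fst)
open Literature.Barriers.CriticalPhenomena (graphBall mem_graphBall_self graphBall_mono)
open BoxProdZ2 (ConcRadiiG Erad Frad nQ nS)
open ChainPlanar ChainPara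
open Skel (winGraph routeW excess WinStepData)
open SkelI (tanOff)
open TwoAxis.Para (modulus detD rep₂)
open SkelConc (Consts)
open Skelφ
open Skelφ.StepI (DataNS OutNS)
open Neg

variable {κ : Consts} {V : Type} [DecidableEq V] [Countable V] {G : SimpleGraph V} [G.LocallyFinite] {Φ : PlanarSkeletonFrmFrom G} {t : V}
  {p : unitInterval} {Pv : NegB.PSlot} {cv hv : NegB.CSlot} {hC : Φ.CylSubcritical p}
  {O : OutNS V} {q : unitInterval}

set_option maxHeartbeats 3200000 in
/-- **Layer (a6) of the (F) wrapper at the Q3V tuple: the numbers batch's frame, zone and band rows discharged** (see the module docstring).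
[cite: KozmaNitzan2024, §4 Lemma 12 (pp. 23–25)] -/
private theorem faceOblRM_frmBVC₆' {κ : Consts} {V : Type} [DecidableEq V] [Countable V] {G : SimpleGraph V} [G.LocallyFinite] {Φ : PlanarSkeletonFrmFrom G} {t : V} {p : unitInterval} {Pv : NegB.PSlot} {cv : NegB.CSlot} {hv : NegB.CSlot} {hC : Φ.CylSubcritical p} {O : OutNS V} {q : unitInterval}
    (mk cW : ℕ)
    (gx fx : Neg.FSlot)
    (hgx : ∀ D : DataNS V, gxFc mk cW κ Φ t p D ≤ gx κ Φ t p D)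
    (hfx : ∀ D : DataNS V, fxFc mk κ Φ t p D ≤ fx κ Φ t p D)
    (ex mx : GSlot)
    (hmx : (prFA κ Φ t p O.merged (KS.gT mk gx κ Φ t p O.merged) (KS.fT mk fx κ Φ t p O.merged)).mF (fcellsA κ Φ t p O.merged (KS.gT mk gx κ Φ t p O.merged) (KS.fT mk fx κ Φ t p O.merged)) ≤ (((mx κ Φ t p O.merged (KS.gT mk gx κ Φ t p O.merged) (KS.fT mk fx κ Φ t p O.merged)) : ℕ) : ℤ))
    (hAt : (choiceAtQ3V κ Φ t p Pv (KS.gT mk gx) (KS.fT mk fx) (SUS ex mx) cv hv BSlot.small3 hC).AtQNQ O q)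
    (h1 : Φ.types = {t})
    (hp0 : 0 < (p : ℝ))
    (hp1 : (p : ℝ) < 1)
    (hMR0 : 4 * Neg.K κ * (KS0.R'0 κ Φ t p O.merged mk + 2) ≤ ML κ Φ t p O.merged (KS.gT mk gx κ Φ t p O.merged))
    (hPx : ((KS.MBF κ Φ t p O.merged cW mk), (KS.nBF κ Φ t p O.merged cW mk)) ∈ (Pv κ Φ t p O.merged).1)
    (Lf : ℕ → ℕ)
    (hCF : ChainFactQT Lf G Φ.Δ κ (κ.δ₂ ^ 3))
    -- the binders of `faceOblRM_fineNb2V` (schemeO side)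
    (hL' : 1 ≤ (Skelφ.Prm.Lp ((SUS ex mx) κ Φ t p O.merged (KS.gT mk gx κ Φ t p O.merged) (KS.fT mk fx κ Φ t p O.merged) q)))
    -- the binders of the keystone `hkits_faceSteps_of_nums6` (kit / route / Λ / numbers)
    {r : ℕ}
    -- THE ROUTE BLOCK (c-uniform; all signs)
    (hRlr : (RL κ Φ t p O (KS.gT mk gx) (KS.fT mk fx)) ≤ r)
    -- the near-`c` block READ BY THE TWO LATTICE FUNCTIONALS (L-F2): bridge regions (every frame sign), hop prism, zone box, fine extents `kA`
    (nB : ℕ)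
    -- the inner-chain fact UP TO THE LENGTH BUDGET `nF` (p3-g11 2026-08-22T02:23:54Z; the wrapper discharges it by `ChainFactF` at `n ≤ LfA K₀`)
    (hRb₀ : (KS0.kit0 t O.merged mk ((((Mu O.merged)) : ℤ) + 2) (KS0.r₀0 t O.merged mk (O.merged.R (O.merged.scale t (KS.MBF κ Φ t p O.merged cW mk) (KS.nBF κ Φ t p O.merged cW mk))))).r₀ ≤ r)
    (hr₁R : (O.merged.R (O.merged.scale t (KS.MBF κ Φ t p O.merged cW mk) (KS.nBF κ Φ t p O.merged cW mk))) ≤ r)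
    (hRr₀ : (KS0.kit0 t O.merged mk (((((Mu O.merged)) + 1 : ℕ) : ℤ) * ((shearUnit (nL κ Φ t p O.merged (KS.gT mk gx κ Φ t p O.merged) (KS.fT mk fx κ Φ t p O.merged)) (prFA κ Φ t p O.merged (KS.gT mk gx κ Φ t p O.merged) (KS.fT mk fx κ Φ t p O.merged)).h) : ℤ) + 1) (KS0.r₀0 t O.merged mk (RL κ Φ t p O (KS.gT mk gx) (KS.fT mk fx)))).r₀ ≤ r)
    (hr₂R : (RL κ Φ t p O (KS.gT mk gx) (KS.fT mk fx)) ≤ r)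
    -- the short region and the zone datum at the kit centres ((S0): inside `Rg`, connected, containing the centre and the fat-prism box `cylBallFin c kz Rk`)
    (hRsr : (KS.Rs t O.merged mk) ≤ r)
    (hρr : (Skelφ.fatRadius Φ.frame hC O.merged.k) ≤ r)
    (hR₁b : ((SUS ex mx κ Φ t p O.merged (KS.gT mk gx κ Φ t p O.merged) (KS.fT mk fx κ Φ t p O.merged) q).Rex (Skelφ.fatRadius Φ.frame hC O.merged.k)) ≤ r - (KS0.kit0 t O.merged mk ((((Mu O.merged)) : ℤ) + 2) (KS0.r₀0 t O.merged mk (O.merged.R (O.merged.scale t (KS.MBF κ Φ t p O.merged cW mk) (KS.nBF κ Φ t p O.merged cW mk))))).r₀)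
    (hR₁r : ((SUS ex mx κ Φ t p O.merged (KS.gT mk gx κ Φ t p O.merged) (KS.fT mk fx κ Φ t p O.merged) q).Rex (Skelφ.fatRadius Φ.frame hC O.merged.k)) ≤ r - (KS0.kit0 t O.merged mk (((((Mu O.merged)) + 1 : ℕ) : ℤ) * ((shearUnit (nL κ Φ t p O.merged (KS.gT mk gx κ Φ t p O.merged) (KS.fT mk fx κ Φ t p O.merged)) (prFA κ Φ t p O.merged (KS.gT mk gx κ Φ t p O.merged) (KS.fT mk fx κ Φ t p O.merged)).h) : ℤ) + 1) (KS0.r₀0 t O.merged mk (RL κ Φ t p O (KS.gT mk gx) (KS.fT mk fx)))).r₀)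
    -- the FACE KIT: constants, exit table rooms, reach, inputs at accuracy `κ.δ₂`
    (hr₀L : (KS0.kit0 t O.merged mk (((((Mu O.merged)) + 1 : ℕ) : ℤ) * (prFA κ Φ t p O.merged (KS.gT mk gx κ Φ t p O.merged) (KS.fT mk fx κ Φ t p O.merged)).D + 1) (KS0.r₀0 t O.merged mk r)).r₀ + 1 ≤ 2 * (Skelφ.Prm.Lp ((SUS ex mx) κ Φ t p O.merged (KS.gT mk gx κ Φ t p O.merged) (KS.fT mk fx κ Φ t p O.merged) q)))
    -- THE PER-CENTRE NUMBERS (x-faces `du.1 = 0`, y′-faces `du.1 = 1`)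
    -- the providers' stride counts within the budget
    -- ONE-SIDED ((R-44)(c)): the numbers' tangential sign is the served sign `1` (one-sided counts `KS.N3WX/N3WY`)
    -- (hp-8 g44) THE NUMBERS BATCH's OWN NODE ROWS: frame rooms at the contact offsets `kEX/kEY` (band `E := Rlev0 + reach0`), the zone bound read by
    -- the two lattice functionals, the one-sided glue rows (x / y′ with `v_L ≥ 0` / y′ with `v_L < 0`), the capacity, the reach budgets, the stride budget
    (hc600 : 600 * Neg.Kq κ ≤ cW)
    (hrX : KS.πBudX κ Φ t p O.merged cW mk (KS.gT mk gx κ Φ t p O.merged) (KS.fT mk fx κ Φ t p O.merged) ≤ r)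
    (hrY : KS.πBudY κ Φ t p O.merged cW mk (KS.gT mk gx κ Φ t p O.merged) (KS.fT mk fx κ Φ t p O.merged) ≤ r)
    (hnB840 : 840 * Neg.Kq κ + 10 ≤ nB)
    -- (hp-8 g44) layer (a4)'s own node row: the bridge core's reach under the kit radius (`|core1Lo|₁ ≤ YbF ≤ r`)
    (hYbr : KS.YbF κ Φ t p O.merged cW mk (KS.gT mk gx κ Φ t p O.merged) (KS.fT mk fx κ Φ t p O.merged) ≤ r)
    -- (hp-8 g44) layer (a5)'s own row: the stride budget under the chain length of record
    (hnBL : nB ≤ Lf κ.K₀)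
    -- (hp-8 g44) layer (a6)'s own NODE ROWS (HypsFW bookkeeping): cap and window rows in the contact slack `A∥ := (hF∥+1)/2 + 5(E−1) + 15`
    (hcapX : 2 * ((((fcellsV κ Φ t p O.merged (KS.gT mk gx κ Φ t p O.merged) (KS.fT mk fx κ Φ t p O.merged) (cOf κ Φ t p O (KS.gT mk gx) (KS.fT mk fx) cv) (hOf κ Φ t p O (KS.gT mk gx) (KS.fT mk fx) hv)).hF 0 : ℤ) + 1) / 2 + (5 * ((((KS0.Rlev0 κ Φ t p O.merged mk + KS0.reach0 t O.merged mk) - 1 : ℕ)) : ℤ) + 15)) + 8 * (KS.u₁A κ Φ t p O.merged (KS.gT mk gx κ Φ t p O.merged) (KS.fT mk fx κ Φ t p O.merged)) + 8 + 2 * ((fcellsV κ Φ t p O.merged (KS.gT mk gx κ Φ t p O.merged) (KS.fT mk fx κ Φ t p O.merged) (cOf κ Φ t p O (KS.gT mk gx) (KS.fT mk fx) cv) (hOf κ Φ t p O (KS.gT mk gx) (KS.fT mk fx) hv)).c 0 : ℤ) ≤ ((fcellsV κ Φ t p O.merged (KS.gT mk gx κ Φ t p O.merged) (KS.fT mk fx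 κ Φ t p O.merged) (cOf κ Φ t p O (KS.gT mk gx) (KS.fT mk fx) cv) (hOf κ Φ t p O (KS.gT mk gx) (KS.fT mk fx) hv)).r 1 : ℤ))
    (hwinX : 2 * ((((fcellsV κ Φ t p O.merged (KS.gT mk gx κ Φ t p O.merged) (KS.fT mk fx κ Φ t p O.merged) (cOf κ Φ t p O (KS.gT mk gx) (KS.fT mk fx) cv) (hOf κ Φ t p O (KS.gT mk gx) (KS.fT mk fx) hv)).hF 0 : ℤ) + 1) / 2 + (5 * ((((KS0.Rlev0 κ Φ t p O.merged mk + KS0.reach0 t O.merged mk) - 1 : ℕ)) : ℤ) + 15)) + ((fcellsV κ Φ t p O.merged (KS.gT mk gx κ Φ t p O.merged) (KS.fT mk fx κ Φ t p O.merged) (cOf κ Φ t p O (KS.gT mk gx) (KS.fT mk fx) cv) (hOf κ Φ t p O (KS.gT mk gx) (KS.fT mk fx) hv)).hF 0 : ℤ) + 6 * (KS.u₁A κ Φ t p O.merged (KS.gT mk gx κ Φ t p O.merged) (KS.fT mk fx κ Φ t p O.merged)) ≤ 2 * ((fcellsV κ Φ t p O.merged (KS.gT mk gx κ Φ t p O.merged)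 (KS.fT mk fx κ Φ t p O.merged) (cOf κ Φ t p O (KS.gT mk gx) (KS.fT mk fx) cv) (hOf κ Φ t p O (KS.gT mk gx) (KS.fT mk fx) hv)).c 0 : ℤ) + 2 * ((KS.bwX κ Φ t p O.merged (KS.gT mk gx κ Φ t p O.merged) (KS.fT mk fx κ Φ t p O.merged)) : ℤ))
    (hcapY : 2 * ((((fcellsV κ Φ t p O.merged (KS.gT mk gx κ Φ t p O.merged) (KS.fT mk fx κ Φ t p O.merged) (cOf κ Φ t p O (KS.gT mk gx) (KS.fT mk fx) cv) (hOf κ Φ t p O (KS.gT mk gx) (KS.fT mk fx) hv)).hF 1 : ℤ) + 1) / 2 + (5 * ((((KS0.Rlev0 κ Φ t p O.merged mk + KS0.reach0 t O.merged mk) - 1 : ℕ)) : ℤ) + 15)) + 24 * (KS.u₀A κ Φ t p O.merged (KS.gT mk gx κ Φ t p O.merged) (KS.fT mk fx κ Φ t p O.merged)) + 24 + 2 * ((fcellsV κ Φ t p O.merged (KS.gT mk gx κ Φ t p O.merged) (KS.fT mk fx κ Φ t p O.merged) (cOf κ Φ t p O (KS.gT mk gx) (KS.fT mk fx) cv) (hOf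 κ Φ t p O (KS.gT mk gx) (KS.fT mk fx) hv)).c 1 : ℤ) ≤ ((fcellsV κ Φ t p O.merged (KS.gT mk gx κ Φ t p O.merged) (KS.fT mk fx κ Φ t p O.merged) (cOf κ Φ t p O (KS.gT mk gx) (KS.fT mk fx) cv) (hOf κ Φ t p O (KS.gT mk gx) (KS.fT mk fx) hv)).r 0 : ℤ))
    (hwinY : 2 * ((((fcellsV κ Φ t p O.merged (KS.gT mk gx κ Φ t p O.merged) (KS.fT mk fx κ Φ t p O.merged) (cOf κ Φ t p O (KS.gT mk gx) (KS.fT mk fx) cv) (hOf κ Φ t p O (KS.gT mk gx) (KS.fT mk fx) hv)).hF 1 : ℤ) + 1) / 2 + (5 * ((((KS0.Rlev0 κ Φ t p O.merged mk + KS0.reach0 t O.merged mk) - 1 : ℕ)) : ℤ) + 15)) + ((fcellsV κ Φ t p O.merged (KS.gT mk gx κ Φ t p O.merged) (KS.fT mk fx κ Φ t p O.merged) (cOf κ Φ t p O (KS.gT mk gx) (KS.fT mk fx) cv) (hOf κ Φ t p O (KS.gT mk gx) (KS.fT mk fx) hv)).hF 1 : ℤ) + 14 * (KS.u₀A κ Φ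 t p O.merged (KS.gT mk gx κ Φ t p O.merged) (KS.fT mk fx κ Φ t p O.merged)) ≤ 2 * ((fcellsV κ Φ t p O.merged (KS.gT mk gx κ Φ t p O.merged) (KS.fT mk fx κ Φ t p O.merged) (cOf κ Φ t p O (KS.gT mk gx) (KS.fT mk fx) cv) (hOf κ Φ t p O (KS.gT mk gx) (KS.fT mk fx) hv)).c 1 : ℤ) + 2 * ((KS.bwY κ Φ t p O.merged (KS.gT mk gx κ Φ t p O.merged) (KS.fT mk fx κ Φ t p O.merged)) : ℤ))
    (hwinYx : 2 * ((((fcellsV κ Φ t p O.merged (KS.gT mk gx κ Φ t p O.merged) (KS.fT mk fx κ Φ t p O.merged) (cOf κ Φ t p O (KS.gT mk gx) (KS.fT mk fx) cv) (hOf κ Φ t p O (KS.gT mk gx) (KS.fT mk fx) hv)).hF 1 : ℤ) + 1) / 2 + (5 * ((((KS0.Rlev0 κ Φ t p O.merged mk + KS0.reach0 t O.merged mk) - 1 : ℕ)) : ℤ) + 15)) + ((fcellsV κ Φ t p O.merged (KS.gT mk gx κ Φ t p O.merged) (KS.fT mk fx κ Φ t p O.merged) (cOf κ Φ t p O (KS.gT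 mk gx) (KS.fT mk fx) cv) (hOf κ Φ t p O (KS.gT mk gx) (KS.fT mk fx) hv)).hF 1 : ℤ) + 24 * (KS.u₀A κ Φ t p O.merged (KS.gT mk gx κ Φ t p O.merged) (KS.fT mk fx κ Φ t p O.merged)) + 10 ≤ 2 * ((fcellsV κ Φ t p O.merged (KS.gT mk gx κ Φ t p O.merged) (KS.fT mk fx κ Φ t p O.merged) (cOf κ Φ t p O (KS.gT mk gx) (KS.fT mk fx) cv) (hOf κ Φ t p O (KS.gT mk gx) (KS.fT mk fx) hv)).c 1 : ℤ) + 2 * ((KS.bwY κ Φ t p O.merged (KS.gT mk gx κ Φ t p O.merged) (KS.fT mk fx κ Φ t p O.merged)) : ℤ)) :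
    Skelφ.FaceOblRMOF G ((choiceAtQ3V κ Φ t p Pv (KS.gT mk gx) (KS.fT mk fx) (SUS ex mx) cv hv BSlot.small3 hC).scheme O q)
      ((choiceAtQ3V κ Φ t p Pv (KS.gT mk gx) (KS.fT mk fx) (SUS ex mx) cv hv BSlot.small3 hC).FD O q) Φ.Δ κ.δ₂ := by
  have hAt3 := atQ3_of_atQ3V hAt
  have hAtT := atQ3T_of_atQ3 hAt3
  have hNL : EqNumL κ Φ t p O.merged (KS.gT mk gx κ Φ t p O.merged) (KS.fT mk fx κ Φ t p O.merged) := eqNumL_of_atQT hAtT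
  have hκ10 : (hL κ Φ t p O.merged (KS.gT mk gx κ Φ t p O.merged) (KS.fT mk fx κ Φ t p O.merged)).natAbs ≤ 10 * nL κ Φ t p O.merged (KS.gT mk gx κ Φ t p O.merged) (KS.fT mk fx κ Φ t p O.merged) := (clauseL_of_atQT hAtT).2
  obtain ⟨hnL1, hℓL1⟩ := one_le_of_eqNumL κ Φ t p O.merged (KS.gT mk gx κ Φ t p O.merged) (KS.fT mk fx κ Φ t p O.merged) hNL
  obtain ⟨hc₀, hc₁⟩ := prFA_c_pos κ Φ t p O.merged (KS.gT mk gx κ Φ t p O.merged) (KS.fT mk fx κ Φ t p O.merged)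
  have hD : 0 < (prFA κ Φ t p O.merged (KS.gT mk gx κ Φ t p O.merged) (KS.fT mk fx κ Φ t p O.merged)).D := prFA_D_pos κ Φ t p O.merged (KS.gT mk gx κ Φ t p O.merged) (KS.fT mk fx κ Φ t p O.merged) hNL
  have hDd := prFA_D κ Φ t p O.merged (KS.gT mk gx κ Φ t p O.merged) (KS.fT mk fx κ Φ t p O.merged)
  have hn : (prFA κ Φ t p O.merged (KS.gT mk gx κ Φ t p O.merged) (KS.fT mk fx κ Φ t p O.merged)).n = (nL κ Φ t p O.merged (KS.gT mk gx κ Φ t p O.merged) (KS.fT mk fx κ Φ t p O.merged)) := (prFA_fields κ Φ t p O.merged (KS.gT mk gx κ Φ t p O.merged) (KS.fT mk fx κ Φ t p O.merged)).2.1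
  have hM := (prFA κ Φ t p O.merged (KS.gT mk gx κ Φ t p O.merged) (KS.fT mk fx κ Φ t p O.merged)).Mabs_pos hc₀ hc₁ hDd hD
  have hE1 : 1 ≤ (KS0.Rlev0 κ Φ t p O.merged mk + KS0.reach0 t O.merged mk) := by unfold KS0.reach0; omega
  have hEc : ((((KS0.Rlev0 κ Φ t p O.merged mk + KS0.reach0 t O.merged mk) - 1 : ℕ)) : ℤ) = ((KS0.Rlev0 κ Φ t p O.merged mk + KS0.reach0 t O.merged mk) : ℤ) - 1 := by omega
  -- the frame rooms at the band (p1-g18's `awF₂V ≥ 0` argument, `FinePrm.hroomF_kFF₂V` at `Rlev := E − 1`)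
  have hnn : ∀ du : MDir, 0 ≤ (prFA κ Φ t p O.merged (KS.gT mk gx κ Φ t p O.merged) (KS.fT mk fx κ Φ t p O.merged)).awF₂V (fcellsV κ Φ t p O.merged (KS.gT mk gx κ Φ t p O.merged) (KS.fT mk fx κ Φ t p O.merged) (cOf κ Φ t p O (KS.gT mk gx) (KS.fT mk fx) cv) (hOf κ Φ t p O (KS.gT mk gx) (KS.fT mk fx) hv)) du := fun du => by
    have hfe : ∀ i : Fin 2, 0 ≤ (fcellsV κ Φ t p O.merged (KS.gT mk gx κ Φ t p O.merged) (KS.fT mk fx κ Φ t p O.merged) (cOf κ Φ t p O (KS.gT mk gx) (KS.fT mk fx) cv) (hOf κ Φ t p O (KS.gT mk gx) (KS.fT mk fx) hv)).faceExt du i := fun i => by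
      unfold PCells2V.faceExt; split_ifs
      · exact le_rfl
      · have h3 : (0 : ℤ) ≤ (fcellsV κ Φ t p O.merged (KS.gT mk gx κ Φ t p O.merged) (KS.fT mk fx κ Φ t p O.merged) (cOf κ Φ t p O (KS.gT mk gx) (KS.fT mk fx) cv) (hOf κ Φ t p O (KS.gT mk gx) (KS.fT mk fx) hv)).hB du.1 := Nat.cast_nonneg _; have h4 : (0 : ℤ) ≤ (fcellsV κ Φ t p O.merged (KS.gT mk gx κ Φ t p O.merged) (KS.fT mk fx κ Φ t p O.merged) (cOf κ Φ t p O (KS.gT mk gx) (KS.fT mk fx) cv) (hOf κ Φ t p O (KS.gT mk gx) (KS.fT mk fx) hv)).hF du.1 := Nat.cast_nonneg _; omega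
    have hrd : ∀ I b, 0 ≤ (prFA κ Φ t p O.merged (KS.gT mk gx κ Φ t p O.merged) (KS.fT mk fx κ Φ t p O.merged)).rdK I b := fun I b => by
      unfold Skelφ.FinePrm.rdK; exact mul_nonneg ((prFA κ Φ t p O.merged (KS.gT mk gx κ Φ t p O.merged) (KS.fT mk fx κ Φ t p O.merged)).cOf_pos hc₀ hc₁ I).le (abs_nonneg _)
    have hnum : 0 ≤ (prFA κ Φ t p O.merged (KS.gT mk gx κ Φ t p O.merged) (KS.fT mk fx κ Φ t p O.merged)).awNumV (fcellsV κ Φ t p O.merged (KS.gT mk gx κ Φ t p O.merged) (KS.fT mk fx κ Φ t p O.merged) (cOf κ Φ t p O (KS.gT mk gx) (KS.fT mk fx) cv) (hOf κ Φ t p O (KS.gT mk gx) (KS.fT mk fx) hv)) du := by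
      unfold Skelφ.FinePrm.awNumV
      have := hfe 0; have := hfe 1; have := hrd 1 ((prFA κ Φ t p O.merged (KS.gT mk gx κ Φ t p O.merged) (KS.fT mk fx κ Φ t p O.merged)).bOf du.1); have := hrd 0 ((prFA κ Φ t p O.merged (KS.gT mk gx κ Φ t p O.merged) (KS.fT mk fx κ Φ t p O.merged)).bOf du.1)
      positivity
    unfold Skelφ.FinePrm.awF₂V
    exact Int.ediv_nonneg (by linarith) hM.le
  have hroomXv :  ∀ du : MDir, du.1 = 0 →
      (prFA κ Φ t p O.merged (KS.gT mk gx κ Φ t p O.merged) (KS.fT mk fx κ Φ t p O.merged)).Mabs * ((fun du : MDir => (((prFA κ Φ t p O.merged (KS.gT mk gx κ Φ t p O.merged) (KS.fT mk fx κ Φ t p O.merged)).awF₂V (fcellsV κ Φ t p O.merged (KS.gT mk gx κ Φ t p O.merged) (KS.fT mk fx κ Φ t p O.merged) (cOf κ Φ t p O (KS.gT mk gx) (KS.fT mk fx) cv) (hOf κ Φ t p O (KS.gT mk gx) (KS.fT mk fx) hv)) du).toNat)) du + (KS0.Rlev0 κ Φ t p O.merged mk + KS0.reach0 t O.merged mk))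 + (prFA κ Φ t p O.merged (KS.gT mk gx κ Φ t p O.merged) (KS.fT mk fx κ Φ t p O.merged)).rdN du.1 ((prFA κ Φ t p O.merged (KS.gT mk gx κ Φ t p O.merged) (KS.fT mk fx κ Φ t p O.merged)).bOf du.1) * ((KS0.Rlev0 κ Φ t p O.merged mk + KS0.reach0 t O.merged mk) + 1) * (prFA κ Φ t p O.merged (KS.gT mk gx κ Φ t p O.merged) (KS.fT mk fx κ Φ t p O.merged)).D ≤ (prFA κ Φ t p O.merged (KS.gT mk gx κ Φ t p O.merged) (KS.fT mk fx κ Φ t p O.merged)).rdK du.1 ((prFA κ Φ t p O.merged (KS.gT mk gx κ Φ t p O.merged) (KS.fT mk fx κ Φ t p O.merged)).bOf du.1) * ((prFA κ Φ t p O.merged (KS.gT mk gx κ Φ t p O.merged) (KS.fT mk fx κ Φ t p O.merged)).kFF₂V (fcellsV κ Φ t p O.merged (KS.gT mk gx κ Φ t p O.merged) (KS.fT mk fx κ Φ t p O.merged) (cOf κ Φ t p O (KS.gT mk gx) (KS.fT mk fx) cv) (hOf κ Φ t p O (KS.gT mk gx) (KS.fT mk fx) hv)) ((KS0.Rlev0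 κ Φ t p O.merged mk + KS0.reach0 t O.merged mk) - 1) 0) * (prFA κ Φ t p O.merged (KS.gT mk gx κ Φ t p O.merged) (KS.fT mk fx κ Φ t p O.merged)).D := by
    intro du hI
    have h := (prFA κ Φ t p O.merged (KS.gT mk gx κ Φ t p O.merged) (KS.fT mk fx κ Φ t p O.merged)).hroomF_kFF₂V hc₀ hc₁ hDd hD (fcellsV κ Φ t p O.merged (KS.gT mk gx κ Φ t p O.merged) (KS.fT mk fx κ Φ t p O.merged) (cOf κ Φ t p O (KS.gT mk gx) (KS.fT mk fx) cv) (hOf κ Φ t p O (KS.gT mk gx) (KS.fT mk fx) hv)) ((KS0.Rlev0 κ Φ t p O.merged mk + KS0.reach0 t O.merged mk) - 1) du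
    have e : (prFA κ Φ t p O.merged (KS.gT mk gx κ Φ t p O.merged) (KS.fT mk fx κ Φ t p O.merged)).kFF₂V (fcellsV κ Φ t p O.merged (KS.gT mk gx κ Φ t p O.merged) (KS.fT mk fx κ Φ t p O.merged) (cOf κ Φ t p O (KS.gT mk gx) (KS.fT mk fx) cv) (hOf κ Φ t p O (KS.gT mk gx) (KS.fT mk fx) hv)) ((KS0.Rlev0 κ Φ t p O.merged mk + KS0.reach0 t O.merged mk) - 1) du.1 = (prFA κ Φ t p O.merged (KS.gT mk gx κ Φ t p O.merged) (KS.fT mk fx κ Φ t p O.merged)).kFF₂V (fcellsV κ Φ t p O.merged (KS.gT mk gx κ Φ t p O.merged) (KS.fT mk fx κ Φ t p O.merged) (cOf κ Φ t p O (KS.gT mk gx) (KS.fT mk fx) cv) (hOf κ Φ t p O (KS.gT mk gx) (KS.fT mk fx) hv)) ((KS0.Rlev0 κ Φ t p O.merged mk + KS0.reach0 t O.merged mk) - 1) 0 := by rw [hI]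
    rw [e, hEc] at h
    show (prFA κ Φ t p O.merged (KS.gT mk gx κ Φ t p O.merged) (KS.fT mk fx κ Φ t p O.merged)).Mabs * (((((prFA κ Φ t p O.merged (KS.gT mk gx κ Φ t p O.merged) (KS.fT mk fx κ Φ t p O.merged)).awF₂V (fcellsV κ Φ t p O.merged (KS.gT mk gx κ Φ t p O.merged) (KS.fT mk fx κ Φ t p O.merged) (cOf κ Φ t p O (KS.gT mk gx) (KS.fT mk fx) cv) (hOf κ Φ t p O (KS.gT mk gx) (KS.fT mk fx) hv)) du).toNat : ℕ) : ℤ) + (((KS0.Rlev0 κ Φ t p O.merged mk + KS0.reach0 t O.merged mk) : ℕ) : ℤ)) + _ ≤ _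
    rw [Int.toNat_of_nonneg (hnn du)]
    push_cast
    nlinarith [h]
  have hroomYv :  ∀ du : MDir, du.1 = 1 →
      (prFA κ Φ t p O.merged (KS.gT mk gx κ Φ t p O.merged) (KS.fT mk fx κ Φ t p O.merged)).Mabs * ((fun du : MDir => (((prFA κ Φ t p O.merged (KS.gT mk gx κ Φ t p O.merged) (KS.fT mk fx κ Φ t p O.merged)).awF₂V (fcellsV κ Φ t p O.merged (KS.gT mk gx κ Φ t p O.merged) (KS.fT mk fx κ Φ t p O.merged) (cOf κ Φ t p O (KS.gT mk gx) (KS.fT mk fx) cv) (hOf κ Φ t p O (KS.gT mk gx) (KS.fT mk fx) hv)) du).toNat)) du + (KS0.Rlev0 κ Φ t p O.merged mk + KS0.reach0 t O.merged mk)) + (prFA κ Φ t p O.merged (KS.gT mk gx κ Φ t p O.merged) (KS.fT mk fx κ Φ t p O.merged)).rdN du.1 ((prFA κ Φ t p O.merged (KS.gT mk gx κ Φ t p O.merged) (KS.fT mk fx κ Φ t p O.merged)).bOf du.1) * ((KS0.Rlev0 κ Φ t p O.merged mk + KS0.reach0 t O.merged mk) + 1) * (prFA κ Φ t p O.merged (KS.gT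 mk gx κ Φ t p O.merged) (KS.fT mk fx κ Φ t p O.merged)).D ≤ (prFA κ Φ t p O.merged (KS.gT mk gx κ Φ t p O.merged) (KS.fT mk fx κ Φ t p O.merged)).rdK du.1 ((prFA κ Φ t p O.merged (KS.gT mk gx κ Φ t p O.merged) (KS.fT mk fx κ Φ t p O.merged)).bOf du.1) * ((prFA κ Φ t p O.merged (KS.gT mk gx κ Φ t p O.merged) (KS.fT mk fx κ Φ t p O.merged)).kFF₂V (fcellsV κ Φ t p O.merged (KS.gT mk gx κ Φ t p O.merged) (KS.fT mk fx κ Φ t p O.merged) (cOf κ Φ t p O (KS.gT mk gx) (KS.fT mk fx) cv) (hOf κ Φ t p O (KS.gT mk gx) (KS.fT mk fx) hv)) ((KS0.Rlev0 κ Φ t p O.merged mk + KS0.reach0 t O.merged mk) - 1) 1) * (prFA κ Φ t p O.merged (KS.gT mk gx κ Φ t p O.merged) (KS.fT mk fx κ Φ t p O.merged)).D := by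
    intro du hI
    have h := (prFA κ Φ t p O.merged (KS.gT mk gx κ Φ t p O.merged) (KS.fT mk fx κ Φ t p O.merged)).hroomF_kFF₂V hc₀ hc₁ hDd hD (fcellsV κ Φ t p O.merged (KS.gT mk gx κ Φ t p O.merged) (KS.fT mk fx κ Φ t p O.merged) (cOf κ Φ t p O (KS.gT mk gx) (KS.fT mk fx) cv) (hOf κ Φ t p O (KS.gT mk gx) (KS.fT mk fx) hv)) ((KS0.Rlev0 κ Φ t p O.merged mk + KS0.reach0 t O.merged mk) - 1) du
    have e : (prFA κ Φ t p O.merged (KS.gT mk gx κ Φ t p O.merged) (KS.fT mk fx κ Φ t p O.merged)).kFF₂V (fcellsV κ Φ t p O.merged (KS.gT mk gx κ Φ t p O.merged) (KS.fT mk fx κ Φ t p O.merged) (cOf κ Φ t p O (KS.gT mk gx) (KS.fT mk fx) cv) (hOf κ Φ t p O (KS.gT mk gx) (KS.fT mk fx) hv)) ((KS0.Rlev0 κ Φ t p O.merged mk + KS0.reach0 t O.merged mk) - 1) du.1 = (prFA κ Φ t p O.merged (KS.gT mk gx κ Φ t p O.merged) (KS.fT mk fx κ Φ t p O.merged)).kFF₂V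 (fcellsV κ Φ t p O.merged (KS.gT mk gx κ Φ t p O.merged) (KS.fT mk fx κ Φ t p O.merged) (cOf κ Φ t p O (KS.gT mk gx) (KS.fT mk fx) cv) (hOf κ Φ t p O (KS.gT mk gx) (KS.fT mk fx) hv)) ((KS0.Rlev0 κ Φ t p O.merged mk + KS0.reach0 t O.merged mk) - 1) 1 := by rw [hI]
    rw [e, hEc] at h
    show (prFA κ Φ t p O.merged (KS.gT mk gx κ Φ t p O.merged) (KS.fT mk fx κ Φ t p O.merged)).Mabs * (((((prFA κ Φ t p O.merged (KS.gT mk gx κ Φ t p O.merged) (KS.fT mk fx κ Φ t p O.merged)).awF₂V (fcellsV κ Φ t p O.merged (KS.gT mk gx κ Φ t p O.merged) (KS.fT mk fx κ Φ t p O.merged) (cOf κ Φ t p O (KS.gT mk gx) (KS.fT mk fx) cv) (hOf κ Φ t p O (KS.gT mk gx) (KS.fT mk fx) hv)) du).toNat : ℕ) : ℤ) + (((KS0.Rlev0 κ Φ t p O.merged mk + KS0.reach0 t O.merged mk) : ℕ) : ℤ)) + _ ≤ _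
    rw [Int.toNat_of_nonneg (hnn du)]
    push_cast
    nlinarith [h]
  -- the zone bound at the seed level through the two lattice functionals
  have hkMu := hk_of_atQ hAt3
  have hMuR : Mu O.merged < KS0.R'0 κ Φ t p O.merged mk := by
    have hKC := (KS0.kit0_ok t O.merged mk (((Mu O.merged) : ℤ) + 2) (KS0.r₀0 t O.merged mk 0) (kq := 0) (by norm_num)).2.2.2.1
    have hReach : KS0.reach0 t O.merged mk < KS0.R'0 κ Φ t p O.merged mk := (KS0.T0_lt_R'0 κ Φ t p O.merged mk).2.2.1
    unfold KS0.reach0 at hReach; omega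
  have hMe : (((Mu O.merged) : ℕ) : ℤ) ≤ ((KS.eF κ Φ t p O.merged cW mk : ℕ) : ℤ) := by
    have : Mu O.merged ≤ KS.eF κ Φ t p O.merged cW mk := by unfold KS.eF; omega
    exact_mod_cast this
  have hmod0 : 0 < modulus (nL κ Φ t p O.merged (KS.gT mk gx κ Φ t p O.merged) (KS.fT mk fx κ Φ t p O.merged)) (hL κ Φ t p O.merged (KS.gT mk gx κ Φ t p O.merged) (KS.fT mk fx κ Φ t p O.merged)) (vL κ Φ t p O.merged (KS.gT mk gx κ Φ t p O.merged) (KS.fT mk fx κ Φ t p O.merged)) (vβL κ Φ t p O.merged (KS.gT mk gx κ Φ t p O.merged) (KS.fT mk fx κ Φ t p O.merged)) := Skelφ.NegPrm.modulus_vβOf_pos hnL1 hℓL1 _ _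
  have hΛZk : (|(prFA κ Φ t p O.merged (KS.gT mk gx κ Φ t p O.merged) (KS.fT mk fx κ Φ t p O.merged)).vβ| + |(prFA κ Φ t p O.merged (KS.gT mk gx κ Φ t p O.merged) (KS.fT mk fx κ Φ t p O.merged)).vα|) * (((Mu O.merged) : ℕ) : ℤ) ≤ KS.ΛF₀ κ Φ t p O.merged cW mk (KS.gT mk gx κ Φ t p O.merged) (KS.fT mk fx κ Φ t p O.merged) ∧ (((nL κ Φ t p O.merged (KS.gT mk gx κ Φ t p O.merged) (KS.fT mk fx κ Φ t p O.merged)) : ℤ) + |(prFA κ Φ t p O.merged (KS.gT mk gx κ Φ t p O.merged) (KS.fT mk fx κ Φ t p O.merged)).h|) * (((Mu O.merged) : ℕ) : ℤ) ≤ KS.ΛF₁ κ Φ t p O.merged cW mk (KS.gT mk gx κ Φ t p O.merged) (KS.fT mk fx κ Φ t p O.merged) := by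
    have e1 : (prFA κ Φ t p O.merged (KS.gT mk gx κ Φ t p O.merged) (KS.fT mk fx κ Φ t p O.merged)).vβ = vβL κ Φ t p O.merged (KS.gT mk gx κ Φ t p O.merged) (KS.fT mk fx κ Φ t p O.merged) := rfl
    have e2 : (prFA κ Φ t p O.merged (KS.gT mk gx κ Φ t p O.merged) (KS.fT mk fx κ Φ t p O.merged)).vα = vL κ Φ t p O.merged (KS.gT mk gx κ Φ t p O.merged) (KS.fT mk fx κ Φ t p O.merged) := rfl
    have e3 : (prFA κ Φ t p O.merged (KS.gT mk gx κ Φ t p O.merged) (KS.fT mk fx κ Φ t p O.merged)).h = hL κ Φ t p O.merged (KS.gT mk gx κ Φ t p O.merged) (KS.fT mk fx κ Φ t p O.merged) := rfl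
    rw [e1, e2, e3]
    have hb := abs_nonneg (vβL κ Φ t p O.merged (KS.gT mk gx κ Φ t p O.merged) (KS.fT mk fx κ Φ t p O.merged)); have ha := abs_nonneg (vL κ Φ t p O.merged (KS.gT mk gx κ Φ t p O.merged) (KS.fT mk fx κ Φ t p O.merged)); have hh := abs_nonneg (hL κ Φ t p O.merged (KS.gT mk gx κ Φ t p O.merged) (KS.fT mk fx κ Φ t p O.merged))
    have hnl : (0 : ℤ) ≤ ((nL κ Φ t p O.merged (KS.gT mk gx κ Φ t p O.merged) (KS.fT mk fx κ Φ t p O.merged)) : ℤ) := by positivity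
    have hl : (0 : ℤ) ≤ ((ℓL κ Φ t p O.merged (KS.gT mk gx κ Φ t p O.merged) (KS.fT mk fx κ Φ t p O.merged)) : ℤ) := by positivity
    constructor
    · unfold KS.ΛF₀
      nlinarith [mul_le_mul_of_nonneg_left hMe hb, mul_le_mul_of_nonneg_left hMe ha, hmod0.le, mul_nonneg hnl hl, mul_nonneg ha hl]
    · unfold KS.ΛF₁
      nlinarith [mul_le_mul_of_nonneg_left hMe (add_nonneg hnl hh), mul_nonneg hnl hl]
  obtain ⟨-, -, -, -, hΛeq⟩ := Skelφ.StepI.OutO.FactsO.seed hAt3.1.factsO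
  have hZ : ∀ c, (↑(O.merged.Λ c (Mu O.merged)) : Set V) ⊆ Skelφ.cyl (φL κ Φ t p O.D O.DT.toDataN O.ori (KS.gT mk gx κ Φ t p O.merged) (KS.fT mk fx κ Φ t p O.merged)) c (Mu O.merged) := fun c => by
    have e : O.merged.Λ c (Mu O.merged) = Skelφ.fatSeq Φ.frame hC c (Mu O.merged) := by
      have := congrFun (congrFun hΛeq c) (Mu O.merged); exact this
    unfold φL; rw [Skelφ.cyl_oriφ, e]; exact Skelφ.fatSeq_subset_cyl Φ.frame hC c _
  have hZb : ∀ c', ∀ v ∈ O.merged.Λ c' (Mu O.merged), (φL κ Φ t p O.D O.DT.toDataN O.ori (KS.gT mk gx κ Φ t p O.merged) (KS.fT mk fx κ Φ t p O.merged)) v - (φL κ Φ t p O.D O.DT.toDataN O.ori (KS.gT mk gx κ Φ t p O.merged) (KS.fT mk fx κ Φ t p O.merged)) c' ∈ box 2 (Mu O.merged) := fun c' v hv =>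
    (Skelφ.mem_cyl (φL κ Φ t p O.D O.DT.toDataN O.ori (KS.gT mk gx κ Φ t p O.merged) (KS.fT mk fx κ Φ t p O.merged)) c' (Mu O.merged) v).1 (hZ c' (Finset.mem_coe.2 hv))
  have hZkv :  ∀ (c' : V) (du : MDir), ∀ v ∈ O.merged.Λ c' (Mu O.merged), |(prFA κ Φ t p O.merged (KS.gT mk gx κ Φ t p O.merged) (KS.fT mk fx κ Φ t p O.merged)).ψ (φL κ Φ t p O.D O.DT.toDataN O.ori (KS.gT mk gx κ Φ t p O.merged) (KS.fT mk fx κ Φ t p O.merged)) c' v du.1| ≤ (fun i : Fin 2 => if i = 0 then KS.kF₀A κ Φ t p O.merged cW mk (KS.gT mk gx κ Φ t p O.merged) (KS.fT mk fx κ Φ t p O.merged) else KS.kF₁A κ Φ t p O.merged cW mk (KS.gT mk gx κ Φ t p O.merged) (KS.fT mk fx κ Φ t p O.merged)) du.1 :=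
    Skelφ.zone_fine_le_of_lam (φ := (φL κ Φ t p O.D O.DT.toDataN O.ori (KS.gT mk gx κ Φ t p O.merged) (KS.fT mk fx κ Φ t p O.merged))) (kA := (fun i : Fin 2 => if i = 0 then KS.kF₀A κ Φ t p O.merged cW mk (KS.gT mk gx κ Φ t p O.merged) (KS.fT mk fx κ Φ t p O.merged) else KS.kF₁A κ Φ t p O.merged cW mk (KS.gT mk gx κ Φ t p O.merged) (KS.fT mk fx κ Φ t p O.merged))) (prFA κ Φ t p O.merged (KS.gT mk gx κ Φ t p O.merged) (KS.fT mk fx κ Φ t p O.merged)) hn hD hc₀.le hc₁.le hΛZk (KS.hkF0_RA κ Φ t p O.merged cW mk (KS.gT mk gx κ Φ t p O.merged) (KS.fT mk fx κ Φ t p O.merged) hNL) (KS.hkF1_RA κ Φ t p O.merged cW mk (KS.gT mk gx κ Φ t p O.merged) (KS.fT mk fx κ Φ t p O.merged) hNL)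
      (fun c' => O.merged.Λ c' (Mu O.merged)) hZb
  -- the band rows (HypsFW bookkeeping at the contact offsets kEX/kEY)
  have hB0 : ((fcellsV κ Φ t p O.merged (KS.gT mk gx κ Φ t p O.merged) (KS.fT mk fx κ Φ t p O.merged) (cOf κ Φ t p O (KS.gT mk gx) (KS.fT mk fx) cv) (hOf κ Φ t p O (KS.gT mk gx) (KS.fT mk fx) hv)).hB 0 : ℤ) = 2 * ((fcellsV κ Φ t p O.merged (KS.gT mk gx κ Φ t p O.merged) (KS.fT mk fx κ Φ t p O.merged) (cOf κ Φ t p O (KS.gT mk gx) (KS.fT mk fx) cv) (hOf κ Φ t p O (KS.gT mk gx) (KS.fT mk fx) hv)).r 1 : ℤ) := by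
    rw [fcellsV_hB, fcellsV_r]; push_cast; rfl
  have hB1 : ((fcellsV κ Φ t p O.merged (KS.gT mk gx κ Φ t p O.merged) (KS.fT mk fx κ Φ t p O.merged) (cOf κ Φ t p O (KS.gT mk gx) (KS.fT mk fx) cv) (hOf κ Φ t p O (KS.gT mk gx) (KS.fT mk fx) hv)).hB 1 : ℤ) = 2 * ((fcellsV κ Φ t p O.merged (KS.gT mk gx κ Φ t p O.merged) (KS.fT mk fx κ Φ t p O.merged) (cOf κ Φ t p O (KS.gT mk gx) (KS.fT mk fx) cv) (hOf κ Φ t p O (KS.gT mk gx) (KS.fT mk fx) hv)).r 0 : ℤ) := by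
    rw [fcellsV_hB, fcellsV_r]; push_cast; rfl
  have hu0 : (0 : ℤ) ≤ (KS.u₀A κ Φ t p O.merged (KS.gT mk gx κ Φ t p O.merged) (KS.fT mk fx κ Φ t p O.merged)) := by unfold KS.u₀A; positivity
  have hu1 : (0 : ℤ) ≤ (KS.u₁A κ Φ t p O.merged (KS.gT mk gx κ Φ t p O.merged) (KS.fT mk fx κ Φ t p O.merged)) := by unfold KS.u₁A; positivity
  have hkX : ((prFA κ Φ t p O.merged (KS.gT mk gx κ Φ t p O.merged) (KS.fT mk fx κ Φ t p O.merged)).kFF₂V (fcellsV κ Φ t p O.merged (KS.gT mk gx κ Φ t p O.merged) (KS.fT mk fx κ Φ t p O.merged) (cOf κ Φ t p O (KS.gT mk gx) (KS.fT mk fx) cv) (hOf κ Φ t p O (KS.gT mk gx) (KS.fT mk fx) hv)) ((KS0.Rlev0 κ Φ t p O.merged mk + KS0.reach0 t O.merged mk) - 1) 0) ≤ (((fcellsV κ Φ t p O.merged (KS.gT mk gx κ Φ t p O.merged) (KS.fT mk fx κ Φ t p O.merged) (cOf κ Φ t p O (KS.gT mk gx) (KS.fT mk fx) cv) (hOf κ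 Φ t p O (KS.gT mk gx) (KS.fT mk fx) hv)).hB 0 : ℤ) + (fcellsV κ Φ t p O.merged (KS.gT mk gx κ Φ t p O.merged) (KS.fT mk fx κ Φ t p O.merged) (cOf κ Φ t p O (KS.gT mk gx) (KS.fT mk fx) cv) (hOf κ Φ t p O (KS.gT mk gx) (KS.fT mk fx) hv)).hF 0 + 1) / 2 + (5 * ((((KS0.Rlev0 κ Φ t p O.merged mk + KS0.reach0 t O.merged mk) - 1 : ℕ)) : ℤ) + 15) := by
    have h := kFF₂V_le_lin κ Φ t p O.merged (KS.fT mk fx κ Φ t p O.merged) mk gx hNL hκ10 (fcellsV κ Φ t p O.merged (KS.gT mk gx κ Φ t p O.merged) (KS.fT mk fx κ Φ t p O.merged) (cOf κ Φ t p O (KS.gT mk gx) (KS.fT mk fx) cv) (hOf κ Φ t p O (KS.gT mk gx) (KS.fT mk fx) hv)) ((KS0.Rlev0 κ Φ t p O.merged mk + KS0.reach0 t O.merged mk) - 1) 0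
    rw [(faceExtV_apply (fcellsV κ Φ t p O.merged (KS.gT mk gx κ Φ t p O.merged) (KS.fT mk fx κ Φ t p O.merged) (cOf κ Φ t p O (KS.gT mk gx) (KS.fT mk fx) cv) (hOf κ Φ t p O (KS.gT mk gx) (KS.fT mk fx) hv)) 0).2] at h; linarith
  have hkY : ((prFA κ Φ t p O.merged (KS.gT mk gx κ Φ t p O.merged) (KS.fT mk fx κ Φ t p O.merged)).kFF₂V (fcellsV κ Φ t p O.merged (KS.gT mk gx κ Φ t p O.merged) (KS.fT mk fx κ Φ t p O.merged) (cOf κ Φ t p O (KS.gT mk gx) (KS.fT mk fx) cv) (hOf κ Φ t p O (KS.gT mk gx) (KS.fT mk fx) hv)) ((KS0.Rlev0 κ Φ t p O.merged mk + KS0.reach0 t O.merged mk) - 1) 1) ≤ (((fcellsV κ Φ t p O.merged (KS.gT mk gx κ Φ t p O.merged) (KS.fT mk fx κ Φ t p O.merged) (cOf κ Φ t p O (KS.gT mk gx) (KS.fT mk fx) cv) (hOf κ Φ t p O (KS.gT mk gx) (KS.fT mk fx) hv)).hB 1 : ℤ) + (fcellsV κ Φ t p O.merged (KS.gT mk gx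 κ Φ t p O.merged) (KS.fT mk fx κ Φ t p O.merged) (cOf κ Φ t p O (KS.gT mk gx) (KS.fT mk fx) cv) (hOf κ Φ t p O (KS.gT mk gx) (KS.fT mk fx) hv)).hF 1 + 1) / 2 + (5 * ((((KS0.Rlev0 κ Φ t p O.merged mk + KS0.reach0 t O.merged mk) - 1 : ℕ)) : ℤ) + 15) := by
    have h := kFF₂V_le_lin κ Φ t p O.merged (KS.fT mk fx κ Φ t p O.merged) mk gx hNL hκ10 (fcellsV κ Φ t p O.merged (KS.gT mk gx κ Φ t p O.merged) (KS.fT mk fx κ Φ t p O.merged) (cOf κ Φ t p O (KS.gT mk gx) (KS.fT mk fx) cv) (hOf κ Φ t p O (KS.gT mk gx) (KS.fT mk fx) hv)) ((KS0.Rlev0 κ Φ t p O.merged mk + KS0.reach0 t O.merged mk) - 1) 1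
    rw [(faceExtV_apply (fcellsV κ Φ t p O.merged (KS.gT mk gx κ Φ t p O.merged) (KS.fT mk fx κ Φ t p O.merged) (cOf κ Φ t p O (KS.gT mk gx) (KS.fT mk fx) cv) (hOf κ Φ t p O (KS.gT mk gx) (KS.fT mk fx) hv)) 1).2] at h; linarith
  have hkEVX : ((prFA κ Φ t p O.merged (KS.gT mk gx κ Φ t p O.merged) (KS.fT mk fx κ Φ t p O.merged)).kFF₂V (fcellsV κ Φ t p O.merged (KS.gT mk gx κ Φ t p O.merged) (KS.fT mk fx κ Φ t p O.merged) (cOf κ Φ t p O (KS.gT mk gx) (KS.fT mk fx) cv) (hOf κ Φ t p O (KS.gT mk gx) (KS.fT mk fx) hv)) ((KS0.Rlev0 κ Φ t p O.merged mk + KS0.reach0 t O.merged mk) - 1) 0) ≤ ((fcellsV κ Φ t p O.merged (KS.gT mk gx κ Φ t p O.merged) (KS.fT mk fx κ Φ t p O.merged) (cOf κ Φ t p O (KS.gT mk gx) (KS.fT mk fx) cv) (hOf κ Φ t p O (KS.gT mk gx) (KS.fT mk fx) hv)).r 1 : ℤ) + ((((fcellsV κ Φ t p O.merged (KS.gT mk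 gx κ Φ t p O.merged) (KS.fT mk fx κ Φ t p O.merged) (cOf κ Φ t p O (KS.gT mk gx) (KS.fT mk fx) cv) (hOf κ Φ t p O (KS.gT mk gx) (KS.fT mk fx) hv)).hF 0 : ℤ) + 1) / 2 + (5 * ((((KS0.Rlev0 κ Φ t p O.merged mk + KS0.reach0 t O.merged mk) - 1 : ℕ)) : ℤ) + 15)) := by
    have h := (fcellsV κ Φ t p O.merged (KS.gT mk gx κ Φ t p O.merged) (KS.fT mk fx κ Φ t p O.merged) (cOf κ Φ t p O (KS.gT mk gx) (KS.fT mk fx) cv) (hOf κ Φ t p O (KS.gT mk gx) (KS.fT mk fx) hv)).contact_rowW 0 hB0 hkX; exact h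
  have hkEVY : ((prFA κ Φ t p O.merged (KS.gT mk gx κ Φ t p O.merged) (KS.fT mk fx κ Φ t p O.merged)).kFF₂V (fcellsV κ Φ t p O.merged (KS.gT mk gx κ Φ t p O.merged) (KS.fT mk fx κ Φ t p O.merged) (cOf κ Φ t p O (KS.gT mk gx) (KS.fT mk fx) cv) (hOf κ Φ t p O (KS.gT mk gx) (KS.fT mk fx) hv)) ((KS0.Rlev0 κ Φ t p O.merged mk + KS0.reach0 t O.merged mk) - 1) 1) ≤ ((fcellsV κ Φ t p O.merged (KS.gT mk gx κ Φ t p O.merged) (KS.fT mk fx κ Φ t p O.merged) (cOf κ Φ t p O (KS.gT mk gx) (KS.fT mk fx) cv) (hOf κ Φ t p O (KS.gT mk gx) (KS.fT mk fx) hv)).r 0 : ℤ) + ((((fcellsV κ Φ t p O.merged (KS.gT mk gx κ Φ t p O.merged) (KS.fT mk fx κ Φ t p O.merged) (cOf κ Φ t p O (KS.gT mk gx) (KS.fT mk fx) cv) (hOf κ Φ t p O (KS.gT mk gx) (KS.fT mk fx) hv)).hF 1 : ℤ) + 1) / 2 + (5 * ((((KS0.Rlev0 κ Φ t p O.merged mk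 + KS0.reach0 t O.merged mk) - 1 : ℕ)) : ℤ) + 15)) := by
    have h := (fcellsV κ Φ t p O.merged (KS.gT mk gx κ Φ t p O.merged) (KS.fT mk fx κ Φ t p O.merged) (cOf κ Φ t p O (KS.gT mk gx) (KS.fT mk fx) cv) (hOf κ Φ t p O (KS.gT mk gx) (KS.fT mk fx) hv)).contact_rowW 1 hB1 hkY; exact h
  have hBX := (fcellsV κ Φ t p O.merged (KS.gT mk gx κ Φ t p O.merged) (KS.fT mk fx κ Φ t p O.merged) (cOf κ Φ t p O (KS.gT mk gx) (KS.fT mk fx) cv) (hOf κ Φ t p O (KS.gT mk gx) (KS.fT mk fx) hv)).bandX_hypsW hB0 hu1 hkEVX hcapX hwinX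
  have hBY := (fcellsV κ Φ t p O.merged (KS.gT mk gx κ Φ t p O.merged) (KS.fT mk fx κ Φ t p O.merged) (cOf κ Φ t p O (KS.gT mk gx) (KS.fT mk fx) cv) (hOf κ Φ t p O (KS.gT mk gx) (KS.fT mk fx) hv)).bandY_hypsW hB1 hu0 hkEVY hcapY hwinY
  have hfwdYxv : 2 * ((prFA κ Φ t p O.merged (KS.gT mk gx κ Φ t p O.merged) (KS.fT mk fx κ Φ t p O.merged)).kFF₂V (fcellsV κ Φ t p O.merged (KS.gT mk gx κ Φ t p O.merged) (KS.fT mk fx κ Φ t p O.merged) (cOf κ Φ t p O (KS.gT mk gx) (KS.fT mk fx) cv) (hOf κ Φ t p O (KS.gT mk gx) (KS.fT mk fx) hv)) ((KS0.Rlev0 κ Φ t p O.merged mk + KS0.reach0 t O.merged mk) - 1) 1) + ((fcellsV κ Φ t p O.merged (KS.gT mk gx κ Φ t p O.merged) (KS.fT mk fx κ Φ t p O.merged) (cOf κ Φ t p O (KS.gT mk gx) (KS.fT mk fx) cv) (hOf κ Φ t p O (KS.gT mk gx) (KS.fT mk fx) hv)).hF 1 : ℤ) - (fcellsV κ Φ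 t p O.merged (KS.gT mk gx κ Φ t p O.merged) (KS.fT mk fx κ Φ t p O.merged) (cOf κ Φ t p O (KS.gT mk gx) (KS.fT mk fx) cv) (hOf κ Φ t p O (KS.gT mk gx) (KS.fT mk fx) hv)).hB 1 + 24 * (KS.u₀A κ Φ t p O.merged (KS.gT mk gx κ Φ t p O.merged) (KS.fT mk fx κ Φ t p O.merged)) + 10 ≤ 2 * (((fcellsV κ Φ t p O.merged (KS.gT mk gx κ Φ t p O.merged) (KS.fT mk fx κ Φ t p O.merged) (cOf κ Φ t p O (KS.gT mk gx) (KS.fT mk fx) cv) (hOf κ Φ t p O (KS.gT mk gx) (KS.fT mk fx) hv)).c 1 : ℤ) + ((KS.bwY κ Φ t p O.merged (KS.gT mk gx κ Φ t p O.merged) (KS.fT mk fx κ Φ t p O.merged)) : ℤ)) := by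
    rw [hB1]; linarith
  exact faceOblRM_frmBVC₅ (kEX := ((prFA κ Φ t p O.merged (KS.gT mk gx κ Φ t p O.merged) (KS.fT mk fx κ Φ t p O.merged)).kFF₂V (fcellsV κ Φ t p O.merged (KS.gT mk gx κ Φ t p O.merged) (KS.fT mk fx κ Φ t p O.merged) (cOf κ Φ t p O (KS.gT mk gx) (KS.fT mk fx) cv) (hOf κ Φ t p O (KS.gT mk gx) (KS.fT mk fx) hv)) ((KS0.Rlev0 κ Φ t p O.merged mk + KS0.reach0 t O.merged mk) - 1) 0)) (kEY := ((prFA κ Φ t p O.merged (KS.gT mk gx κ Φ t p O.merged) (KS.fT mk fx κ Φ t p O.merged)).kFF₂V (fcellsV κ Φ t p O.merged (KS.gT mk gx κ Φ t p O.merged) (KS.fT mk fx κ Φ t p O.merged) (cOf κ Φ t p O (KS.gT mk gx) (KS.fT mk fx) cv) (hOf κ Φ t p O (KS.gT mk gx) (KS.fT mk fx) hv)) ((KS0.Rlev0 κ Φ t p O.merged mk + KS0.reach0 t O.merged mk) - 1) 1)) mk cW gx fx hgx hfx ex mx hmx hAt h1 hp0 hp1 hMR0 hPx Lf hCF hL'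 hRlr nB hRb₀ hr₁R hRr₀ hr₂R hRsr hρr hR₁b hR₁r hr₀L hroomXv hroomYv hZkv hBX.1 hBX.2.1 hBX.2.2 hBY.1 hBY.2.1 hBY.2.2.1 hBY.2.2.2 hfwdYxv hc600 hrX hrY hnB840 hYbr hnBL

end NegB

end PlanarSkeletonFrmFrom

end Summit.CriticalPhenomena.PercolationContinuityZ3.Theorems.Transplant

end

/-!
# N2 (frames-only node, OPEN) — (F) column, THE WRAPPER's LAYER (a7): `NegB.faceOblRM_frmBVC₇` = layer (a6) `faceOblRM_frmBVC₆` WITH THE SLOT ROWS DISCHARGED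
(carried INSIDE this file as a PRIVATE theorem under lead g20 RULING F-C 2026-08-26T04:03:48Z: the landed host «SkelFrmBFaceBVC7» p415867 is a build-queue
casualty (accepted 01:30:42Z, never dispatched); statement and body verbatim, name primed; see that module for the full docstring.)
builds on p205010 (kernel theorem, internal audit signed; external expert review pending) — nothing here uses p205010; NOTHING is claimed about the open node
`SamePDropOfSkeletonFrmFrom₁`. [cite: KozmaNitzan2024, §4 Lemma 11–12 (pp. 21–25), Theorem 6 (pp. 25–31)] [cite: MartineauTassion2017, §4.3]
-/

noncomputable section

open scoped Classical ENNReal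

namespace Summit.CriticalPhenomena.PercolationContinuityZ3.Theorems.Transplant

namespace PlanarSkeletonFrmFrom

namespace NegB

open MeasureTheory Literature.Probability.Percolation Literature.Probability.LatticeModels SimpleGraph KNCells KNLevels GadgetSystem Contour
open Literature.Probability.Percolation.KozmaNitzan
open Literature.Probability.Percolation.KozmaNitzan.Cells (oth sgOf sgOf_sign stepVec_apply_fst)
open Literature.Barriers.CriticalPhenomena (graphBall mem_graphBall_self graphBall_mono)
open BoxProdZ2 (ConcRadiiG Erad Frad nQ nS)
open ChainPlanar ChainPara
open Skel (winGraph routeW excess WinStepData)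
open SkelI (tanOff)
open TwoAxis.Para (modulus detD rep₂)
open SkelConc (Consts)
open Skelφ
open Skelφ.StepI (DataNS OutNS)
open Neg

variable {κ : Consts} {V : Type} [DecidableEq V] [Countable V] {G : SimpleGraph V} [G.LocallyFinite] {Φ : PlanarSkeletonFrmFrom G} {t : V}
  {p : unitInterval} {Pv : NegB.PSlot} {cv hv : NegB.CSlot} {hC : Φ.CylSubcritical p}
  {O : OutNS V} {q : unitInterval}

set_option maxHeartbeats 3200000 in
/-- **Layer (a7) of the (F) wrapper at the Q3V tuple: the slot rows discharged at `r := L′(SUS ex mx)`, `nB := Lf K₀`** (see the module docstring).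
[cite: KozmaNitzan2024, §4 Lemma 12 (pp. 23–25)] -/
private theorem faceOblRM_frmBVC₇' {κ : Consts} {V : Type} [DecidableEq V] [Countable V] {G : SimpleGraph V} [G.LocallyFinite] {Φ : PlanarSkeletonFrmFrom G} {t : V} {p : unitInterval} {Pv : NegB.PSlot} {cv : NegB.CSlot} {hv : NegB.CSlot} {hC : Φ.CylSubcritical p} {O : OutNS V} {q : unitInterval}
    (mk cW : ℕ)
    (gx fx : Neg.FSlot)
    (hgx : ∀ D : DataNS V, gxFc mk cW κ Φ t p D ≤ gx κ Φ t p D)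
    (hfx : ∀ D : DataNS V, fxFc mk κ Φ t p D ≤ fx κ Φ t p D)
    (ex mx : GSlot)
    (hex : ∀ (D : DataNS V) (g f : ℕ), exF2 mk cW κ Φ t p D g f ≤ ex κ Φ t p D g f)
    (hmx : (prFA κ Φ t p O.merged (KS.gT mk gx κ Φ t p O.merged) (KS.fT mk fx κ Φ t p O.merged)).mF (fcellsA κ Φ t p O.merged (KS.gT mk gx κ Φ t p O.merged) (KS.fT mk fx κ Φ t p O.merged)) ≤ (((mx κ Φ t p O.merged (KS.gT mk gx κ Φ t p O.merged) (KS.fT mk fx κ Φ t p O.merged)) : ℕ) : ℤ))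
    (hAt : (choiceAtQ3V κ Φ t p Pv (KS.gT mk gx) (KS.fT mk fx) (SUS ex mx) cv hv BSlot.small3 hC).AtQNQ O q)
    (h1 : Φ.types = {t})
    (hp0 : 0 < (p : ℝ))
    (hp1 : (p : ℝ) < 1)
    (hPx : ((KS.MBF κ Φ t p O.merged cW mk), (KS.nBF κ Φ t p O.merged cW mk)) ∈ (Pv κ Φ t p O.merged).1)
    (Lf : ℕ → ℕ)
    (hCF : ChainFactQT Lf G Φ.Δ κ (κ.δ₂ ^ 3))
    (hLf : 840 * Neg.Kq κ + 10 ≤ Lf κ.K₀)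
    -- the two lattice functionals, the one-sided glue rows (x / y′ with `v_L ≥ 0` / y′ with `v_L < 0`), the capacity, the reach budgets, the stride budget
    (hc600 : 600 * Neg.Kq κ ≤ cW)
    -- (hp-8 g44) layer (a6)'s own NODE ROWS (HypsFW bookkeeping): cap and window rows in the contact slack `A∥ := (hF∥+1)/2 + 5(E−1) + 15`
    (hcapX : 2 * ((((fcellsV κ Φ t p O.merged (KS.gT mk gx κ Φ t p O.merged) (KS.fT mk fx κ Φ t p O.merged) (cOf κ Φ t p O (KS.gT mk gx) (KS.fT mk fx) cv) (hOf κ Φ t p O (KS.gT mk gx) (KS.fT mk fx) hv)).hF 0 : ℤ) + 1) / 2 + (5 * ((((KS0.Rlev0 κ Φ t p O.merged mk + KS0.reach0 t O.merged mk) - 1 : ℕ)) : ℤ) + 15)) + 8 * (KS.u₁A κ Φ t p O.merged (KS.gT mk gx κ Φ t p O.merged) (KS.fT mk fx κ Φ t p O.merged)) + 8 + 2 * ((fcellsV κ Φ t p O.merged (KS.gT mk gx κ Φ t p O.merged) (KS.fT mk fx κ Φ t p O.merged) (cOf κ Φ t p O (KS.gT mk gx) (KS.fT mk fx) cv) (hOf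 κ Φ t p O (KS.gT mk gx) (KS.fT mk fx) hv)).c 0 : ℤ) ≤ ((fcellsV κ Φ t p O.merged (KS.gT mk gx κ Φ t p O.merged) (KS.fT mk fx κ Φ t p O.merged) (cOf κ Φ t p O (KS.gT mk gx) (KS.fT mk fx) cv) (hOf κ Φ t p O (KS.gT mk gx) (KS.fT mk fx) hv)).r 1 : ℤ))
    (hwinX : 2 * ((((fcellsV κ Φ t p O.merged (KS.gT mk gx κ Φ t p O.merged) (KS.fT mk fx κ Φ t p O.merged) (cOf κ Φ t p O (KS.gT mk gx) (KS.fT mk fx) cv) (hOf κ Φ t p O (KS.gT mk gx) (KS.fT mk fx) hv)).hF 0 : ℤ) + 1) / 2 + (5 * ((((KS0.Rlev0 κ Φ t p O.merged mk + KS0.reach0 t O.merged mk) - 1 : ℕ)) : ℤ) + 15)) + ((fcellsV κ Φ t p O.merged (KS.gT mk gx κ Φ t p O.merged) (KS.fT mk fx κ Φ t p O.merged) (cOf κ Φ t p O (KS.gT mk gx) (KS.fT mk fx) cv) (hOf κ Φ t p O (KS.gT mk gx) (KS.fT mk fx) hv)).hF 0 : ℤ) + 6 * (KS.u₁A κ Φ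 t p O.merged (KS.gT mk gx κ Φ t p O.merged) (KS.fT mk fx κ Φ t p O.merged)) ≤ 2 * ((fcellsV κ Φ t p O.merged (KS.gT mk gx κ Φ t p O.merged) (KS.fT mk fx κ Φ t p O.merged) (cOf κ Φ t p O (KS.gT mk gx) (KS.fT mk fx) cv) (hOf κ Φ t p O (KS.gT mk gx) (KS.fT mk fx) hv)).c 0 : ℤ) + 2 * ((KS.bwX κ Φ t p O.merged (KS.gT mk gx κ Φ t p O.merged) (KS.fT mk fx κ Φ t p O.merged)) : ℤ))
    (hcapY : 2 * ((((fcellsV κ Φ t p O.merged (KS.gT mk gx κ Φ t p O.merged) (KS.fT mk fx κ Φ t p O.merged) (cOf κ Φ t p O (KS.gT mk gx) (KS.fT mk fx) cv) (hOf κ Φ t p O (KS.gT mk gx) (KS.fT mk fx) hv)).hF 1 : ℤ) + 1) / 2 + (5 * ((((KS0.Rlev0 κ Φ t p O.merged mk + KS0.reach0 t O.merged mk) - 1 : ℕ)) : ℤ) + 15)) + 24 * (KS.u₀A κ Φ t p O.merged (KS.gT mk gx κ Φ t p O.merged) (KS.fT mk fx κ Φ t p O.merged)) + 24 + 2 * ((fcellsV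 κ Φ t p O.merged (KS.gT mk gx κ Φ t p O.merged) (KS.fT mk fx κ Φ t p O.merged) (cOf κ Φ t p O (KS.gT mk gx) (KS.fT mk fx) cv) (hOf κ Φ t p O (KS.gT mk gx) (KS.fT mk fx) hv)).c 1 : ℤ) ≤ ((fcellsV κ Φ t p O.merged (KS.gT mk gx κ Φ t p O.merged) (KS.fT mk fx κ Φ t p O.merged) (cOf κ Φ t p O (KS.gT mk gx) (KS.fT mk fx) cv) (hOf κ Φ t p O (KS.gT mk gx) (KS.fT mk fx) hv)).r 0 : ℤ))
    (hwinY : 2 * ((((fcellsV κ Φ t p O.merged (KS.gT mk gx κ Φ t p O.merged) (KS.fT mk fx κ Φ t p O.merged) (cOf κ Φ t p O (KS.gT mk gx) (KS.fT mk fx) cv) (hOf κ Φ t p O (KS.gT mk gx) (KS.fT mk fx) hv)).hF 1 : ℤ) + 1) / 2 + (5 * ((((KS0.Rlev0 κ Φ t p O.merged mk + KS0.reach0 t O.merged mk) - 1 : ℕ)) : ℤ) + 15)) + ((fcellsV κ Φ t p O.merged (KS.gT mk gx κ Φ t p O.merged) (KS.fT mk fx κ Φ t p O.merged) (cOf κ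 Φ t p O (KS.gT mk gx) (KS.fT mk fx) cv) (hOf κ Φ t p O (KS.gT mk gx) (KS.fT mk fx) hv)).hF 1 : ℤ) + 14 * (KS.u₀A κ Φ t p O.merged (KS.gT mk gx κ Φ t p O.merged) (KS.fT mk fx κ Φ t p O.merged)) ≤ 2 * ((fcellsV κ Φ t p O.merged (KS.gT mk gx κ Φ t p O.merged) (KS.fT mk fx κ Φ t p O.merged) (cOf κ Φ t p O (KS.gT mk gx) (KS.fT mk fx) cv) (hOf κ Φ t p O (KS.gT mk gx) (KS.fT mk fx) hv)).c 1 : ℤ) + 2 * ((KS.bwY κ Φ t p O.merged (KS.gT mk gx κ Φ t p O.merged) (KS.fT mk fx κ Φ t p O.merged)) : ℤ))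
    (hwinYx : 2 * ((((fcellsV κ Φ t p O.merged (KS.gT mk gx κ Φ t p O.merged) (KS.fT mk fx κ Φ t p O.merged) (cOf κ Φ t p O (KS.gT mk gx) (KS.fT mk fx) cv) (hOf κ Φ t p O (KS.gT mk gx) (KS.fT mk fx) hv)).hF 1 : ℤ) + 1) / 2 + (5 * ((((KS0.Rlev0 κ Φ t p O.merged mk + KS0.reach0 t O.merged mk) - 1 : ℕ)) : ℤ) + 15)) + ((fcellsV κ Φ t p O.merged (KS.gT mk gx κ Φ t p O.merged) (KS.fT mk fx κ Φ t p O.merged) (cOf κ Φ t p O (KS.gT mk gx) (KS.fT mk fx) cv) (hOf κ Φ t p O (KS.gT mk gx) (KS.fT mk fx) hv)).hF 1 : ℤ) + 24 * (KS.u₀A κ Φ t p O.merged (KS.gT mk gx κ Φ t p O.merged) (KS.fT mk fx κ Φ t p O.merged)) + 10 ≤ 2 * ((fcellsV κ Φ t p O.merged (KS.gT mk gx κ Φ t p O.merged) (KS.fT mk fx κ Φ t p O.merged) (cOf κ Φ t p O (KS.gT mk gx) (KS.fT mk fx) cv) (hOf κ Φ t p O (KS.gT mk gx) (KS.fT mk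 fx) hv)).c 1 : ℤ) + 2 * ((KS.bwY κ Φ t p O.merged (KS.gT mk gx κ Φ t p O.merged) (KS.fT mk fx κ Φ t p O.merged)) : ℤ)) :
    Skelφ.FaceOblRMOF G ((choiceAtQ3V κ Φ t p Pv (KS.gT mk gx) (KS.fT mk fx) (SUS ex mx) cv hv BSlot.small3 hC).scheme O q)
      ((choiceAtQ3V κ Φ t p Pv (KS.gT mk gx) (KS.fT mk fx) (SUS ex mx) cv hv BSlot.small3 hC).FD O q) Φ.Δ κ.δ₂ := by
  -- the residual floors at `(O.merged, g, f)` (ResidF2), the slot formula `L′(SUS) = ex + Rex(2ψπ) + 24·rmax′ + 3ψπ + 48` (SlotsS)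
  obtain ⟨hRs, hRb0, hRL0, hYb, hb0, hre0, hπXv, hπYv⟩ := floors_of_ge2 hex O.merged (KS.gT mk gx κ Φ t p O.merged) (KS.fT mk fx κ Φ t p O.merged)
  have hLp := Lp_SUS_eq κ Φ t p O.merged (KS.gT mk gx κ Φ t p O.merged) (KS.fT mk fx κ Φ t p O.merged) ex mx q
  have hexLp := (ex_le_Lp_US κ Φ t p O.merged (KS.gT mk gx κ Φ t p O.merged) (KS.fT mk fx κ Φ t p O.merged) ex mx q).1
  have hψ := ψπ_eq Φ hC O.merged
  have hRbg := KS0.r₀0_ge t O.merged mk (O.merged.R (O.merged.toDataN.scale t (KS.MBF κ Φ t p O.merged cW mk) (KS.nBF κ Φ t p O.merged cW mk)))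
  have hRLg := KS0.r₀0_ge t O.merged mk (RLD κ Φ t p O.merged (KS.gT mk gx κ Φ t p O.merged) (KS.fT mk fx κ Φ t p O.merged))
  have eRL : (RL κ Φ t p O (KS.gT mk gx) (KS.fT mk fx)) = (RLD κ Φ t p O.merged (KS.gT mk gx κ Φ t p O.merged) (KS.fT mk fx κ Φ t p O.merged)) := rfl
  have er₀ : ∀ (A : ℤ) (X : ℕ), (KS0.kit0 t O.merged mk A X).r₀ = X := fun _ _ => rfl
  have eRex : ∀ X : ℕ, ((SUS ex mx) κ Φ t p O.merged (KS.gT mk gx κ Φ t p O.merged) (KS.fT mk fx κ Φ t p O.merged) q).Rex X = Rex κ Φ (mRS κ Φ t p O.merged (KS.gT mk gx κ Φ t p O.merged) (KS.fT mk fx κ Φ t p O.merged) (mx κ Φ t p O.merged (KS.gT mk gx κ Φ t p O.merged) (KS.fT mk fx κ Φ t p O.merged))) q X := fun _ => rfl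
  have hmono : Rex κ Φ (mRS κ Φ t p O.merged (KS.gT mk gx κ Φ t p O.merged) (KS.fT mk fx κ Φ t p O.merged) (mx κ Φ t p O.merged (KS.gT mk gx κ Φ t p O.merged) (KS.fT mk fx κ Φ t p O.merged))) q (Skelφ.fatRadius Φ.frame hC O.merged.k) ≤ Rex κ Φ (mRS κ Φ t p O.merged (KS.gT mk gx κ Φ t p O.merged) (KS.fT mk fx κ Φ t p O.merged) (mx κ Φ t p O.merged (KS.gT mk gx κ Φ t p O.merged) (KS.fT mk fx κ Φ t p O.merged))) q (2 * ψπ Φ p O.merged) :=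
    Rex_mono κ Φ _ q (by rw [← hψ]; omega)
  -- the box row `4·K·(R′0+2) ≤ M_L` (`K = 40·Kq`, ResidF `hR0F_of_ge`)
  have hMR0v :  4 * Neg.K κ * (KS0.R'0 κ Φ t p O.merged mk + 2) ≤ ML κ Φ t p O.merged (KS.gT mk gx κ Φ t p O.merged) := by
    have h := (hR0F_of_ge hgx O.merged).1
    have h4 : 4 * Neg.K κ ≤ 22000 * Neg.Kq κ := by rw [Neg.K_eq]; omega
    exact (Nat.mul_le_mul_right (KS0.R'0 κ Φ t p O.merged mk + 2) h4).trans h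
  -- the slot rows at `r := L′(SUS ex mx)`
  have hL'v :  1 ≤ (Skelφ.Prm.Lp ((SUS ex mx) κ Φ t p O.merged (KS.gT mk gx κ Φ t p O.merged) (KS.fT mk fx κ Φ t p O.merged) q)) := by omega
  have hRlrv :  (RL κ Φ t p O (KS.gT mk gx) (KS.fT mk fx)) ≤ (Skelφ.Prm.Lp ((SUS ex mx) κ Φ t p O.merged (KS.gT mk gx κ Φ t p O.merged) (KS.fT mk fx κ Φ t p O.merged) q)) := by rw [eRL]; omega
  have hr₂Rv :  (RL κ Φ t p O (KS.gT mk gx) (KS.fT mk fx)) ≤ (Skelφ.Prm.Lp ((SUS ex mx) κ Φ t p O.merged (KS.gT mk gx κ Φ t p O.merged) (KS.fT mk fx κ Φ t p O.merged) q)) := by rw [eRL]; omega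
  have hRb₀v :  (KS0.kit0 t O.merged mk ((((Mu O.merged)) : ℤ) + 2) (KS0.r₀0 t O.merged mk (O.merged.R (O.merged.scale t (KS.MBF κ Φ t p O.merged cW mk) (KS.nBF κ Φ t p O.merged cW mk))))).r₀ ≤ (Skelφ.Prm.Lp ((SUS ex mx) κ Φ t p O.merged (KS.gT mk gx κ Φ t p O.merged) (KS.fT mk fx κ Φ t p O.merged) q)) := by rw [er₀]; omega
  have hr₁Rv :  (O.merged.R (O.merged.scale t (KS.MBF κ Φ t p O.merged cW mk) (KS.nBF κ Φ t p O.merged cW mk))) ≤ (Skelφ.Prm.Lp ((SUS ex mx) κ Φ t p O.merged (KS.gT mk gx κ Φ t p O.merged) (KS.fT mk fx κ Φ t p O.merged) q)) := by omega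
  have hRr₀v :  (KS0.kit0 t O.merged mk (((((Mu O.merged)) + 1 : ℕ) : ℤ) * ((shearUnit (nL κ Φ t p O.merged (KS.gT mk gx κ Φ t p O.merged) (KS.fT mk fx κ Φ t p O.merged)) (prFA κ Φ t p O.merged (KS.gT mk gx κ Φ t p O.merged) (KS.fT mk fx κ Φ t p O.merged)).h) : ℤ) + 1) (KS0.r₀0 t O.merged mk (RL κ Φ t p O (KS.gT mk gx) (KS.fT mk fx)))).r₀ ≤ (Skelφ.Prm.Lp ((SUS ex mx) κ Φ t p O.merged (KS.gT mk gx κ Φ t p O.merged) (KS.fT mk fx κ Φ t p O.merged) q)) := by rw [er₀, eRL]; omega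
  have hRsrv :  (KS.Rs t O.merged mk) ≤ (Skelφ.Prm.Lp ((SUS ex mx) κ Φ t p O.merged (KS.gT mk gx κ Φ t p O.merged) (KS.fT mk fx κ Φ t p O.merged) q)) := by omega
  have hρrv :  (Skelφ.fatRadius Φ.frame hC O.merged.k) ≤ (Skelφ.Prm.Lp ((SUS ex mx) κ Φ t p O.merged (KS.gT mk gx κ Φ t p O.merged) (KS.fT mk fx κ Φ t p O.merged) q)) := by rw [← hψ]; omega
  have hR₁bv :  ((SUS ex mx κ Φ t p O.merged (KS.gT mk gx κ Φ t p O.merged) (KS.fT mk fx κ Φ t p O.merged) q).Rex (Skelφ.fatRadius Φ.frame hC O.merged.k)) ≤ (Skelφ.Prm.Lp ((SUS ex mx) κ Φ t p O.merged (KS.gT mk gx κ Φ t p O.merged) (KS.fT mk fx κ Φ t p O.merged) q)) - (KS0.kit0 t O.merged mk ((((Mu O.merged)) : ℤ) + 2) (KS0.r₀0 t O.merged mk (O.merged.R (O.merged.scale t (KS.MBF κ Φ t p O.merged cW mk) (KS.nBF κ Φ t p O.merged cW mk))))).r₀ := by rw [eRex, er₀]; omega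
  have hR₁rv :  ((SUS ex mx κ Φ t p O.merged (KS.gT mk gx κ Φ t p O.merged) (KS.fT mk fx κ Φ t p O.merged) q).Rex (Skelφ.fatRadius Φ.frame hC O.merged.k)) ≤ (Skelφ.Prm.Lp ((SUS ex mx) κ Φ t p O.merged (KS.gT mk gx κ Φ t p O.merged) (KS.fT mk fx κ Φ t p O.merged) q)) - (KS0.kit0 t O.merged mk (((((Mu O.merged)) + 1 : ℕ) : ℤ) * ((shearUnit (nL κ Φ t p O.merged (KS.gT mk gx κ Φ t p O.merged) (KS.fT mk fx κ Φ t p O.merged)) (prFA κ Φ t p O.merged (KS.gT mk gx κ Φ t p O.merged) (KS.fT mk fx κ Φ t p O.merged)).h) : ℤ) + 1) (KS0.r₀0 t O.merged mk (RL κ Φ t p O (KS.gT mk gx) (KS.fT mk fx)))).r₀ := by rw [eRex, er₀, eRL]; omega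
  have hr₀Lv :  (KS0.kit0 t O.merged mk (((((Mu O.merged)) + 1 : ℕ) : ℤ) * (prFA κ Φ t p O.merged (KS.gT mk gx κ Φ t p O.merged) (KS.fT mk fx κ Φ t p O.merged)).D + 1) (KS0.r₀0 t O.merged mk (Skelφ.Prm.Lp ((SUS ex mx) κ Φ t p O.merged (KS.gT mk gx κ Φ t p O.merged) (KS.fT mk fx κ Φ t p O.merged) q)))).r₀ + 1 ≤ 2 * (Skelφ.Prm.Lp ((SUS ex mx) κ Φ t p O.merged (KS.gT mk gx κ Φ t p O.merged) (KS.fT mk fx κ Φ t p O.merged) q)) := by rw [er₀]; unfold KS0.r₀0; omega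
  have hYbrv :  KS.YbF κ Φ t p O.merged cW mk (KS.gT mk gx κ Φ t p O.merged) (KS.fT mk fx κ Φ t p O.merged) ≤ (Skelφ.Prm.Lp ((SUS ex mx) κ Φ t p O.merged (KS.gT mk gx κ Φ t p O.merged) (KS.fT mk fx κ Φ t p O.merged) q)) := by omega
  have hrXv :  KS.πBudX κ Φ t p O.merged cW mk (KS.gT mk gx κ Φ t p O.merged) (KS.fT mk fx κ Φ t p O.merged) ≤ (Skelφ.Prm.Lp ((SUS ex mx) κ Φ t p O.merged (KS.gT mk gx κ Φ t p O.merged) (KS.fT mk fx κ Φ t p O.merged) q)) := by omega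
  have hrYv :  KS.πBudY κ Φ t p O.merged cW mk (KS.gT mk gx κ Φ t p O.merged) (KS.fT mk fx κ Φ t p O.merged) ≤ (Skelφ.Prm.Lp ((SUS ex mx) κ Φ t p O.merged (KS.gT mk gx κ Φ t p O.merged) (KS.fT mk fx κ Φ t p O.merged) q)) := by omega
  exact faceOblRM_frmBVC₆' (r := (Skelφ.Prm.Lp ((SUS ex mx) κ Φ t p O.merged (KS.gT mk gx κ Φ t p O.merged) (KS.fT mk fx κ Φ t p O.merged) q))) mk cW gx fx hgx hfx ex mx hmx hAt h1 hp0 hp1 hMR0v hPx Lf hCF hL'v hRlrv (Lf κ.K₀) hRb₀v hr₁Rv hRr₀v hr₂Rv hRsrv hρrv hR₁bv hR₁rv hr₀Lv hc600 hrXv hrYv hLf hYbrv le_rfl hcapX hwinX hcapY hwinY hwinYx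

end NegB

end PlanarSkeletonFrmFrom

end Summit.CriticalPhenomena.PercolationContinuityZ3.Theorems.Transplant

end

/-!
# N2 (frames-only node, OPEN) — (F) column, THE TUPLE-GENERIC (F) WRAPPER UNDER THE K-FLOOR: `NegB.faceHoldsRNQFnLTK_frmChoiceAllQ3V_of`
# (hp-8 g44; generated by bin/gen_holdsv.py)
**`FaceHoldsRNQFnLTK Lf (fun x => x ^ 3) Kmin (frmChoiceAllQ3V (KS.gT mk gx) (KS.fT mk fx) Pv (SUS ex mx) cv hv BSlot.small3)`** — the (F) column Prop of
the closure of record `samePDropOfSkeletonFrmFrom₁_of_choiceFnNQLTK` (SkelFrm1ChoiceLTK) for the choice function of record at the Q3V tuple SHAPE (box slot in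
K-slot form `KS.gT mk gx`, width `KS.fT mk fx`, fibre block `SUS ex mx`, arrival box `small3`; pairs `Pv`, creep `cv hv` free) — from layer (a7)
`faceOblRM_frmBVC₇` (the keystone `Skelφ.faceOblRM_of_kits9VC` with every binder group discharged), GIVEN, under the K-floor `Kmin ≤ κ.K₀`:
the residual dominations `gxFc mk (cW κ) ≤ gx`, `fxFc mk ≤ fx`, `exF2 mk (cW κ) ≤ ex` (ResidF/ResidF2), the block ceiling `hmx : m_F ≤ mx`, the bridge pair in the
pair slot `hPx`, the length budget `hLf : 840·Kq + 10 ≤ Lf K₀`, the window constant `hc600 : 600·Kq ≤ cW κ`, and the FIVE NODE ROWS (cap / window rows in the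
contact slack, `hrows`, read under `AtQNQ`).  The node file instantiates `mk := 0`, `Kmin := 200`, `cW := cF`, the tuple's `gxQ/fxQ/exQ/mxQ/PxQ/cR2W/hFR` and
discharges the eight hypotheses from stmt's value files (`le_gxQ/le_fxQ/le_exQ`, `subset_PR_PxQ`, creep caps) — `faceHoldsRNQFnLTK_frmChoiceAllQ3V`.
`FaceHoldsRNQ`/`AtQNQ`/`scheme`/`FD` of `frmChoiceAllQ3V …` unfold to those of `NegB.choiceAtQ3V …` by `rfl` (`frmChoiceAllQ3V_eq`).
builds on p205010 (kernel theorem, internal audit signed; external expert review pending) — nothing here uses p205010; NOTHING is claimed about the open node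
`SamePDropOfSkeletonFrmFrom₁`.
Lane `prim-bschramm`, seat `prim-hp-8` (gen 44); helper file (`--supports stmt-CriticalPhenomena-4575 --as helper`).
[cite: KozmaNitzan2024, §4 Lemma 11–12 (pp. 21–25), Theorem 6 (pp. 25–31)] [cite: MartineauTassion2017, §4.3]
-/

noncomputable section

open scoped Classical ENNReal

namespace Summit.CriticalPhenomena.PercolationContinuityZ3.Theorems.Transplant

namespace PlanarSkeletonFrmFrom

namespace NegB

open MeasureTheory Literature.Probability.Percolation Literature.Probability.LatticeModels SimpleGraph KNCells KNLevels GadgetSystem Contour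
open Literature.Probability.Percolation.KozmaNitzan
open Literature.Probability.Percolation.KozmaNitzan.Cells (oth sgOf sgOf_sign stepVec_apply_fst)
open Literature.Barriers.CriticalPhenomena (graphBall mem_graphBall_self graphBall_mono)
open BoxProdZ2 (ConcRadiiG Erad Frad nQ nS)
open ChainPlanar ChainPara
open Skel (winGraph routeW excess WinStepData)
open SkelI (tanOff)
open TwoAxis.Para (modulus detD rep₂)
open SkelConc (Consts)
open Skelφ
open Skelφ.StepI (DataNS OutNS)
open Neg

set_option maxHeartbeats 1600000 in
/-- **The tuple-generic (F) wrapper under the K-floor** (see the module docstring). [cite: KozmaNitzan2024, §4 Lemma 12 (pp. 23–25), Theorem 6 (pp. 25–31)] -/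
theorem faceHoldsRNQFnLTK_frmChoiceAllQ3V_of (mk Kmin : ℕ) (cW : Consts → ℕ) (gx fx : Neg.FSlot) (ex mx : GSlot) (Pv : NegB.PSlot) (cv hv : NegB.CSlot)
    (Lf : ℕ → ℕ)
    (hgx : ∀ (κ : Consts) {V : Type} [DecidableEq V] [Countable V] {G : SimpleGraph V} [G.LocallyFinite] (Φ : PlanarSkeletonFrmFrom G) (t : V) (p : unitInterval) (D : DataNS V), Kmin ≤ κ.K₀ → gxFc mk (cW κ) κ Φ t p D ≤ gx κ Φ t p D)
    (hfx : ∀ (κ : Consts) {V : Type} [DecidableEq V] [Countable V] {G : SimpleGraph V} [G.LocallyFinite] (Φ : PlanarSkeletonFrmFrom G) (t : V) (p : unitInterval) (D : DataNS V), Kmin ≤ κ.K₀ → fxFc mk κ Φ t p D ≤ fx κ Φ t p D)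
    (hex : ∀ (κ : Consts) {V : Type} [DecidableEq V] [Countable V] {G : SimpleGraph V} [G.LocallyFinite] (Φ : PlanarSkeletonFrmFrom G) (t : V) (p : unitInterval) (D : DataNS V) (g f : ℕ), Kmin ≤ κ.K₀ → exF2 mk (cW κ) κ Φ t p D g f ≤ ex κ Φ t p D g f)
    (hmx : ∀ (κ : Consts) {V : Type} [DecidableEq V] [Countable V] {G : SimpleGraph V} [G.LocallyFinite] (Φ : PlanarSkeletonFrmFrom G) (t : V) (p : unitInterval) (D : DataNS V) (g f : ℕ),
      (prFA κ Φ t p D g f).mF (fcellsA κ Φ t p D g f) ≤ (((mx κ Φ t p D g f) : ℕ) : ℤ))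
    (hPx : ∀ (κ : Consts) {V : Type} [DecidableEq V] [Countable V] {G : SimpleGraph V} [G.LocallyFinite] (Φ : PlanarSkeletonFrmFrom G) (t : V) (p : unitInterval) (D : DataNS V), Kmin ≤ κ.K₀ → ((KS.MBF κ Φ t p D (cW κ) mk), (KS.nBF κ Φ t p D (cW κ) mk)) ∈ (Pv κ Φ t p D).1)
    (hLf : ∀ κ : Consts, Kmin ≤ κ.K₀ → 840 * Neg.Kq κ + 10 ≤ Lf κ.K₀)
    (hc600 : ∀ κ : Consts, Kmin ≤ κ.K₀ → 600 * Neg.Kq κ ≤ cW κ)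
    (hrows : ∀ (κ : Consts) {V : Type} [DecidableEq V] [Countable V] {G : SimpleGraph V} [G.LocallyFinite] (Φ : PlanarSkeletonFrmFrom G) (t : V) (p : unitInterval) (hC : Φ.CylSubcritical p) (O : OutNS V) (q : unitInterval),
      Kmin ≤ κ.K₀ → (choiceAtQ3V κ Φ t p Pv (KS.gT mk gx) (KS.fT mk fx) (SUS ex mx) cv hv BSlot.small3 hC).AtQNQ O q →
        (2 * ((((fcellsV κ Φ t p O.merged (KS.gT mk gx κ Φ t p O.merged) (KS.fT mk fx κ Φ t p O.merged) (cOf κ Φ t p O (KS.gT mk gx) (KS.fT mk fx) cv) (hOf κ Φ t p O (KS.gT mk gx) (KS.fT mk fx) hv)).hF 0 : ℤ) + 1) / 2 + (5 * ((((KS0.Rlev0 κ Φ t p O.merged mk + KS0.reach0 t O.merged mk) - 1 : ℕ)) : ℤ) + 15)) + 8 * (KS.u₁A κ Φ t p O.merged (KS.gT mk gx κ Φ t p O.merged) (KS.fT mk fx κ Φ t p O.merged)) + 8 + 2 * ((fcellsV κ Φ t p O.merged (KS.gT mk gx κ Φ t p O.merged) (KS.fT mk fx κ Φ t p O.merged)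 (cOf κ Φ t p O (KS.gT mk gx) (KS.fT mk fx) cv) (hOf κ Φ t p O (KS.gT mk gx) (KS.fT mk fx) hv)).c 0 : ℤ) ≤ ((fcellsV κ Φ t p O.merged (KS.gT mk gx κ Φ t p O.merged) (KS.fT mk fx κ Φ t p O.merged) (cOf κ Φ t p O (KS.gT mk gx) (KS.fT mk fx) cv) (hOf κ Φ t p O (KS.gT mk gx) (KS.fT mk fx) hv)).r 1 : ℤ)) ∧
        (2 * ((((fcellsV κ Φ t p O.merged (KS.gT mk gx κ Φ t p O.merged) (KS.fT mk fx κ Φ t p O.merged) (cOf κ Φ t p O (KS.gT mk gx) (KS.fT mk fx) cv) (hOf κ Φ t p O (KS.gT mk gx) (KS.fT mk fx) hv)).hF 0 : ℤ) + 1) / 2 + (5 * ((((KS0.Rlev0 κ Φ t p O.merged mk + KS0.reach0 t O.merged mk) - 1 : ℕ)) : ℤ) + 15)) + ((fcellsV κ Φ t p O.merged (KS.gT mk gx κ Φ t p O.merged) (KS.fT mk fx κ Φ t p O.merged) (cOf κ Φ t p O (KS.gT mk gx) (KS.fT mk fx) cv) (hOf κ Φ t p O (KS.gT mk gx) (KS.fT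 mk fx) hv)).hF 0 : ℤ) + 6 * (KS.u₁A κ Φ t p O.merged (KS.gT mk gx κ Φ t p O.merged) (KS.fT mk fx κ Φ t p O.merged)) ≤ 2 * ((fcellsV κ Φ t p O.merged (KS.gT mk gx κ Φ t p O.merged) (KS.fT mk fx κ Φ t p O.merged) (cOf κ Φ t p O (KS.gT mk gx) (KS.fT mk fx) cv) (hOf κ Φ t p O (KS.gT mk gx) (KS.fT mk fx) hv)).c 0 : ℤ) + 2 * ((KS.bwX κ Φ t p O.merged (KS.gT mk gx κ Φ t p O.merged) (KS.fT mk fx κ Φ t p O.merged)) : ℤ)) ∧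
        (2 * ((((fcellsV κ Φ t p O.merged (KS.gT mk gx κ Φ t p O.merged) (KS.fT mk fx κ Φ t p O.merged) (cOf κ Φ t p O (KS.gT mk gx) (KS.fT mk fx) cv) (hOf κ Φ t p O (KS.gT mk gx) (KS.fT mk fx) hv)).hF 1 : ℤ) + 1) / 2 + (5 * ((((KS0.Rlev0 κ Φ t p O.merged mk + KS0.reach0 t O.merged mk) - 1 : ℕ)) : ℤ) + 15)) + 24 * (KS.u₀A κ Φ t p O.merged (KS.gT mk gx κ Φ t p O.merged) (KS.fT mk fx κ Φ t p O.merged)) + 24 + 2 * ((fcellsV κ Φ t p O.merged (KS.gT mk gx κ Φ t p O.merged) (KS.fT mk fx κ Φ t p O.merged) (cOf κ Φ t p O (KS.gT mk gx) (KS.fT mk fx) cv) (hOf κ Φ t p O (KS.gT mk gx) (KS.fT mk fx) hv)).c 1 : ℤ) ≤ ((fcellsV κ Φ t p O.merged (KS.gT mk gx κ Φ t p O.merged) (KS.fT mk fx κ Φ t p O.merged) (cOf κ Φ t p O (KS.gT mk gx) (KS.fT mk fx) cv) (hOf κ Φ t p O (KS.gT mk gx) (KS.fT mk fx) hv)).r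 0 : ℤ)) ∧
        (2 * ((((fcellsV κ Φ t p O.merged (KS.gT mk gx κ Φ t p O.merged) (KS.fT mk fx κ Φ t p O.merged) (cOf κ Φ t p O (KS.gT mk gx) (KS.fT mk fx) cv) (hOf κ Φ t p O (KS.gT mk gx) (KS.fT mk fx) hv)).hF 1 : ℤ) + 1) / 2 + (5 * ((((KS0.Rlev0 κ Φ t p O.merged mk + KS0.reach0 t O.merged mk) - 1 : ℕ)) : ℤ) + 15)) + ((fcellsV κ Φ t p O.merged (KS.gT mk gx κ Φ t p O.merged) (KS.fT mk fx κ Φ t p O.merged) (cOf κ Φ t p O (KS.gT mk gx) (KS.fT mk fx) cv) (hOf κ Φ t p O (KS.gT mk gx) (KS.fT mk fx) hv)).hF 1 : ℤ) + 14 * (KS.u₀A κ Φ t p O.merged (KS.gT mk gx κ Φ t p O.merged) (KS.fT mk fx κ Φ t p O.merged)) ≤ 2 * ((fcellsV κ Φ t p O.merged (KS.gT mk gx κ Φ t p O.merged) (KS.fT mk fx κ Φ t p O.merged) (cOf κ Φ t p O (KS.gT mk gx) (KS.fT mk fx) cv) (hOf κ Φ t p O (KS.gT mk gx) (KS.fT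 mk fx) hv)).c 1 : ℤ) + 2 * ((KS.bwY κ Φ t p O.merged (KS.gT mk gx κ Φ t p O.merged) (KS.fT mk fx κ Φ t p O.merged)) : ℤ)) ∧
        (2 * ((((fcellsV κ Φ t p O.merged (KS.gT mk gx κ Φ t p O.merged) (KS.fT mk fx κ Φ t p O.merged) (cOf κ Φ t p O (KS.gT mk gx) (KS.fT mk fx) cv) (hOf κ Φ t p O (KS.gT mk gx) (KS.fT mk fx) hv)).hF 1 : ℤ) + 1) / 2 + (5 * ((((KS0.Rlev0 κ Φ t p O.merged mk + KS0.reach0 t O.merged mk) - 1 : ℕ)) : ℤ) + 15)) + ((fcellsV κ Φ t p O.merged (KS.gT mk gx κ Φ t p O.merged) (KS.fT mk fx κ Φ t p O.merged) (cOf κ Φ t p O (KS.gT mk gx) (KS.fT mk fx) cv) (hOf κ Φ t p O (KS.gT mk gx) (KS.fT mk fx) hv)).hF 1 : ℤ) + 24 * (KS.u₀A κ Φ t p O.merged (KS.gT mk gx κ Φ t p O.merged) (KS.fT mk fx κ Φ t p O.merged)) + 10 ≤ 2 * ((fcellsV κ Φ t p O.merged (KS.gT mk gx κ Φ t p O.merged)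 (KS.fT mk fx κ Φ t p O.merged) (cOf κ Φ t p O (KS.gT mk gx) (KS.fT mk fx) cv) (hOf κ Φ t p O (KS.gT mk gx) (KS.fT mk fx) hv)).c 1 : ℤ) + 2 * ((KS.bwY κ Φ t p O.merged (KS.gT mk gx κ Φ t p O.merged) (KS.fT mk fx κ Φ t p O.merged)) : ℤ)))
    : FaceHoldsRNQFnLTK Lf (fun x => x ^ 3) Kmin (frmChoiceAllQ3V (KS.gT mk gx) (KS.fT mk fx) Pv (SUS ex mx) cv hv BSlot.small3) := by
  intro κ V _ _ G _ Φ hg t ht h1 p hp0 hp1 hC hK hFl hCF O q hAt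
  obtain ⟨hcapX, hwinX, hcapY, hwinY, hwinYx⟩ := hrows κ Φ t p hC O q hK hAt
  exact faceOblRM_frmBVC₇' mk (cW κ) gx fx (fun D => hgx κ Φ t p D hK) (fun D => hfx κ Φ t p D hK) ex mx (fun D g f => hex κ Φ t p D g f hK)
    (hmx κ Φ t p _ _ _) hAt h1 hp0 hp1 (hPx κ Φ t p _ hK) Lf hCF (hLf κ hK) (hc600 κ hK) hcapX hwinX hcapY hwinY hwinYx

end NegB

end PlanarSkeletonFrmFrom

end Summit.CriticalPhenomena.PercolationContinuityZ3.Theorems.Transplant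

end
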